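import Literature.Computability.Cryptography.WordRAMExec
import Literature.Computability.Cryptography.FGProblemZoo
import HarnessLib

/-!
# Negative Triangle `≤₃` APSP: the word-RAM program and its symbolic execution

Vassilevska Williams–Williams, J. ACM 65 (2018), Thm. 1.1, direction (3) `≤₃` (1): Negative Triangle
reduces to APSP by a subcubic reduction. In print the route is Negative Triangle `≤₃` matrix product
verification (Thm. 4.1, p. 27:14) `≤₃` distance product `≤₃` APSP (the classical encoding of a
distance product as a shortest-path computation; cf. the two-layer gadget with shifted weights in
the proof of Thm. 5.1, p. 27:22, there for undirected APSP). The prelude renders `≤₃` as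
`FGReducible` (VVW ICM 2018, Def. 2.1): the existence of a concrete deterministic word-RAM oracle
program (`WordRAM.Program`). This file writes that program down — it makes **one** APSP query, on the *layered triangle graph* of
`Literature.Computability.Cryptography.LayeredTriangleGraph` (`4 n` vertices: copy `ℓ` of vertex `a`
is vertex `ℓ n + a`; an arc of weight `W a b` from copy `ℓ` of `a` to copy `ℓ + 1` of `b ≠ a`), and
then tests whether one of the `n` distances from copy `0` of `i` to copy `3` of `i` is negative — and
executes it symbolically, phase by phase. The assembly into
`FGReducible (NegativeTriangle c) (n ↦ n³) (APSP c) (n ↦ n³)` (query = encoding of the layered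
graph, answer decoding, time and ledger budgets) is
`Literature.Computability.FineGrained.NegativeTriangleToAPSP`.

## Input, memory layout, registers

The input is `x = encodeMatrixWithTop (W.map (↑))` for `W : Matrix (Fin n) (Fin n) ℤ`
(`inp W`): `mem 0 = n² + 1` (the length), `mem 1 = n`, `mem (2 + t) = code W t` for `t < n²`, where
`code W (i n + j) = encodeInt (W i j) + 1 ≥ 1` (row-major), everything else `0`. Since the word RAM
has no registers, the program first moves the data out of the way:

* **Phase 1, bootstrap** (instructions 0–8, `5 n² + 5` steps, `run_boot`): using only cells `0`
  and `1` as pointers, copy `n` to the *far base* `F = n² + 33` and the `n²` codes to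
  `F + 1, …, F + n²` (the copy loop stops at the first zero cell, `n² + 2`). State: `bootMem W w t`.
* From then on memory is kept in the normal form `mkMem R H` — *registers* `R` in cells `< 21`,
  *heap* `H` in cells `≥ 21` — and every phase is an `∃ R'`-statement about the registers it sets
  (`RegsA`, `RegsC`) together with an explicit heap.
* **Phase 2, setup** (instructions 9–23, 15 steps, `run_setup`): registers `2 ↦ n`, `3 ↦ N = 4n`,
  `4 ↦ n²`, `5 ↦ F + 1`, `6 ↦ Q` (query base, `Q = F + 1 + n²`), `7 ↦ Q + n + 1`, `8 ↦ S = n N + n`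
  (the stride between the three arcs of a pair), `9 ↦ LEN = N² + 1` (query length),
  `10 ↦ A0 = Q + LEN` (answer base), `11 ↦ 0` (loop counter); and `mem Q := N`. Heap: `heap0`.
* **Phase 3, loop A** (instructions 24–42, `19` steps per iteration, `n²` iterations, `run_loopA`,
  exit test `run_loopA_exit`): iteration `t = i n + j` reads `code W t`, multiplies it by `[i ≠ j]`
  (`arcVal`) and writes it at the three offsets `moff n t ℓ`, `ℓ = 0, 1, 2`, of the row-major
  `N × N` query matrix at `Q + 1` (the arcs `i_ℓ → j_{ℓ+1}`). All other cells of the query matrix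
  stay `0`, the code of `⊤` (no arc). Heap after `t` iterations: `heapA W w t` (described through the
  offset decoders `lu, ia, lv, jb` and the predicate `Written`).
* **Phase 4, the query** (instruction 43, `run_query`): `query Q LEN A0`; the oracle's answer `ans`
  (reduced modulo `2 ^ w` by the machine) is written at `A0 + 1, …` with its length at `A0`
  (`heapQ`), and the query segment `qseg W w` enters the query log.
* **Phases 5–7, loop C and output** (instructions 44–64; `run_postq` 6 steps, `run_loopC` `12`
  steps per iteration, `n` iterations, `run_finish` 5 steps): iteration `t` reads the answer word
  `entry ans n t` at offset `1 + 3 n + t (N + 1)` (the code of the distance from vertex `t` to vertex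
  `3 n + t`) and ors `condVal` of it — `1` iff the word is nonzero and even, i.e. the code of a
  negative integer — into a flag (`flagC`); finally `mem 1 := flag`, `mem 0 := 1`, `halt`, so the
  output is `[flag]`.

## Hypotheses

The word size `w` must hold the input (`inputWidth (inp W) ≤ w`, so that `init` does not truncate)
and all addresses and counters (`bnd n = 40 (n² + 2) ≤ 2 ^ w`); loop C additionally assumes the
answer words are `< 2 ^ w` and that the answer has length `LEN n`. The assembly file discharges
these for `w = (c + 7) · inputWidth` and the genuine APSP answer.

## Proof technique

Plain symbolic execution on `WordRAM.run` (`Literature.Computability.Cryptography.WordRAMExec`):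
one `have eᵢ : step … = …` per instruction, each closed by a uniform `simp only` normaliser for
register reads through `mkMem`/`Function.update` followed by the exact arithmetic of the operation
(`eval_add`, … under the no-overflow side conditions), then `run_succ_of_step` to chain them;
loops by induction on the iteration count with the closed-form heaps `bootMem`, `heapA`, and
`run_add_of_run` to concatenate phases.

## References

* V. Vassilevska Williams, R. R. Williams, *Subcubic equivalences between path, matrix, and triangle
  problems*, J. ACM 65 (2018), Art. 27, Thm. 1.1 (p. 27:3), §4 and Thm. 4.1 (p. 27:13–14),
  proof of Thm. 5.1 (p. 27:22). doi:10.1145/3186893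
* V. Vassilevska Williams, *On some fine-grained questions in algorithms and complexity*, Proc. ICM
  2018, §2 (word RAM, Def. 2.1).
* T. Hagerup, *Sorting and searching on the word RAM*, STACS 1998, §2 (the unit-cost word RAM).
-/

-- The symbolic-execution proofs below use one uniform `simp only` read-normaliser per instruction;
-- not every lemma of the set fires at every instruction.
set_option linter.unusedSimpArgs false

namespace Literature.Computability.FineGrained.NegTriToAPSP

open Cryptography Cryptography.WordRAM

/-! ### The program -/

/-- The reduction program (see the memory-layout table in the module docstring): this file's own
layered rendering of VW–W 2018, Thm. 1.1, (3) `≤₃` (1) (in print via Thm. 4.1, p. 27:14).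
[cite: VassilevskaWilliamsWilliams2018, Thm. 1.1 ((3) ≤₃ (1)); cf. Thm. 4.1 (p. 27:14)] -/
def prog : Program :=
  [ -- bootstrap: move `n` and the matrix codes to the far region `F = n² + 33`
    .op .add (.dir 0) (.dir 0) (.imm 32),      -- 0:  c0 := |x| + 32 = n² + 33 = F
    .op .add (.ind 0) (.dir 1) (.imm 0),       -- 1:  mem[F] := n
    .op .add (.dir 0) (.dir 0) (.imm 1),       -- 2:  c0 := F + 1        (destination pointer)
    .op .add (.dir 1) (.imm 2) (.imm 0),       -- 3:  c1 := 2            (source pointer)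
    .jz (.ind 1) 9,                            -- 4:  while mem[c1] ≠ 0:
    .op .add (.ind 0) (.ind 1) (.imm 0),       -- 5:    mem[c0] := mem[c1]
    .op .add (.dir 0) (.dir 0) (.imm 1),       -- 6:    c0 += 1
    .op .add (.dir 1) (.dir 1) (.imm 1),       -- 7:    c1 += 1
    .jmp 4,                                    -- 8:
    -- setup of the registers 2‥20 (now free)
    .op .add (.dir 5) (.dir 1) (.imm 32),      -- 9:  FB := n² + 34 = F + 1
    .op .sub (.dir 4) (.dir 1) (.imm 2),       -- 10: nsq := n²
    .op .sub (.dir 1) (.dir 5) (.imm 1),       -- 11: c1 := F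
    .op .add (.dir 2) (.ind 1) (.imm 0),       -- 12: rn := mem[F] = n
    .op .mul (.dir 3) (.dir 2) (.imm 4),       -- 13: rN := 4 n
    .op .add (.dir 6) (.dir 0) (.imm 0),       -- 14: Q := F + 1 + n²    (query segment base)
    .op .add (.ind 0) (.dir 3) (.imm 0),       -- 15: mem[Q] := N
    .op .add (.dir 7) (.dir 6) (.dir 2),       -- 16: Q1n := Q + n
    .op .add (.dir 7) (.dir 7) (.imm 1),       -- 17: Q1n := Q + n + 1
    .op .mul (.dir 8) (.dir 2) (.dir 3),       -- 18: S := n N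
    .op .add (.dir 8) (.dir 8) (.dir 2),       -- 19: S := n N + n       (layer stride)
    .op .mul (.dir 9) (.dir 3) (.dir 3),       -- 20: LEN := N²
    .op .add (.dir 9) (.dir 9) (.imm 1),       -- 21: LEN := N² + 1      (query length)
    .op .add (.dir 10) (.dir 6) (.dir 9),      -- 22: A0 := Q + N² + 1   (answer base)
    .op .add (.dir 11) (.imm 0) (.imm 0),      -- 23: idx := 0
    -- loop A: write the three arcs of each ordered pair `(i, j)`, `idx = i n + j`
    .op .lt (.dir 14) (.dir 11) (.dir 4),      -- 24: t := idx < n²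
    .jz (.dir 14) 43,                          -- 25: exit when idx = n²
    .op .div (.dir 12) (.dir 11) (.dir 2),     -- 26: i := idx / n
    .op .mod (.dir 13) (.dir 11) (.dir 2),     -- 27: j := idx % n
    .op .eq (.dir 14) (.dir 12) (.dir 13),     -- 28: t := (i = j)
    .op .eq (.dir 14) (.dir 14) (.imm 0),      -- 29: t := (i ≠ j)
    .op .add (.dir 16) (.dir 5) (.dir 11),     -- 30: p := FB + idx
    .op .add (.dir 15) (.ind 16) (.imm 0),     -- 31: val := mem[FB + idx] = code (W i j)
    .op .mul (.dir 15) (.dir 15) (.dir 14),    -- 32: val := val · [i ≠ j]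
    .op .mul (.dir 16) (.dir 12) (.dir 3),     -- 33: p := i N
    .op .add (.dir 16) (.dir 16) (.dir 7),     -- 34: p := Q + 1 + i N + n
    .op .add (.dir 16) (.dir 16) (.dir 13),    -- 35: p := Q + 1 + i N + n + j   (arc i₀ → j₁)
    .op .add (.ind 16) (.dir 15) (.imm 0),     -- 36: mem[p] := val
    .op .add (.dir 16) (.dir 16) (.dir 8),     -- 37: p += S                        (arc i₁ → j₂)
    .op .add (.ind 16) (.dir 15) (.imm 0),     -- 38: mem[p] := val
    .op .add (.dir 16) (.dir 16) (.dir 8),     -- 39: p += S                        (arc i₂ → j₃)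
    .op .add (.ind 16) (.dir 15) (.imm 0),     -- 40: mem[p] := val
    .op .add (.dir 11) (.dir 11) (.imm 1),     -- 41: idx += 1
    .jmp 24,                                   -- 42:
    -- the query, then loop C: is some distance `d(i₀, i₃)` negative?
    .query (.dir 6) (.dir 9) (.dir 10),        -- 43: APSP oracle on mem[Q ‥ Q + N²]; answer at A0
    .op .mul (.dir 19) (.dir 2) (.imm 3),      -- 44: A3 := 3 n
    .op .add (.dir 19) (.dir 19) (.dir 10),    -- 45: A3 := A0 + 3 n
    .op .add (.dir 19) (.dir 19) (.imm 2),     -- 46: A3 := A0 + 2 + 3 n   (address of d(0₀, 0₃))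
    .op .add (.dir 20) (.dir 3) (.imm 1),      -- 47: N1 := N + 1           (stride of i ↦ d(i₀, i₃))
    .op .add (.dir 11) (.imm 0) (.imm 0),      -- 48: idx := 0
    .op .add (.dir 17) (.imm 0) (.imm 0),      -- 49: flag := 0
    .op .lt (.dir 14) (.dir 11) (.dir 2),      -- 50: t := idx < n
    .jz (.dir 14) 62,                          -- 51: exit when idx = n
    .op .mul (.dir 16) (.dir 11) (.dir 20),    -- 52: p := idx (N + 1)
    .op .add (.dir 16) (.dir 16) (.dir 19),    -- 53: p := A3 + idx (N + 1)
    .op .add (.dir 15) (.ind 16) (.imm 0),     -- 54: val := mem[p] = code (d(idx₀, idx₃))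
    .op .eq (.dir 14) (.dir 15) (.imm 0),      -- 55: t := (val = 0)
    .op .band (.dir 18) (.dir 15) (.imm 1),    -- 56: t2 := val &&& 1
    .op .bor (.dir 14) (.dir 14) (.dir 18),    -- 57: t := t ||| t2
    .op .eq (.dir 14) (.dir 14) (.imm 0),      -- 58: t := (val ≠ 0 ∧ val even) = (d < 0)
    .op .bor (.dir 17) (.dir 17) (.dir 14),    -- 59: flag := flag ||| t
    .op .add (.dir 11) (.dir 11) (.imm 1),     -- 60: idx += 1
    .jmp 50,                                   -- 61:
    .op .add (.dir 1) (.dir 17) (.imm 0),      -- 62: mem[1] := flag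
    .op .add (.dir 0) (.imm 1) (.imm 0),       -- 63: mem[0] := 1        (output `[flag]`)
    .halt ]                                    -- 64:

/-- The program has 65 instructions. [folklore] -/
theorem prog_length : prog.length = 65 := rfl

/-- The program uses no `rand` instruction. [folklore] -/
theorem prog_isDeterministic : prog.IsDeterministic := by decide

/-! ### Small arithmetic -/

/-- `(i n + j) / n = i` for `j < n`. [folklore] -/
theorem div_of_mul_add {n i j : ℕ} (hj : j < n) : (i * n + j) / n = i := by
  rw [Nat.add_comm, Nat.add_mul_div_right _ _ (Nat.zero_lt_of_lt hj), Nat.div_eq_of_lt hj, Nat.zero_add]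

/-- Row-major offsets stay inside the matrix: `i n + j < n²` for `i, j < n`. [folklore] -/
theorem mul_add_lt_mul {n i j : ℕ} (hi : i < n) (hj : j < n) : i * n + j < n * n := by
  calc i * n + j < i * n + n := by omega
    _ = (i + 1) * n := by ring
    _ ≤ n * n := Nat.mul_le_mul_right _ hi

/-- Row-major offsets stay inside the matrix (variant with the bound named `N`). [folklore] -/
theorem mul_add_lt_mul' {N u v : ℕ} (hu : u < N) (hv : v < N) : u * N + v < N * N :=
  mul_add_lt_mul hu hv

/-- `Fin.divNat` of the row-major offset `i n + j` is `i`. [folklore] -/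
theorem divNat_mk_mul_add {m n : ℕ} (i : Fin m) (j : Fin n) (h : (i : ℕ) * n + j < m * n) :
    Fin.divNat ⟨i * n + j, h⟩ = i := by
  ext; simp [div_of_mul_add j.is_lt]

/-- `Fin.modNat` of the row-major offset `i n + j` is `j`. [folklore] -/
theorem modNat_mk_mul_add {m n : ℕ} (i : Fin m) (j : Fin n) (h : (i : ℕ) * n + j < m * n) :
    Fin.modNat ⟨i * n + j, h⟩ = j := by
  ext; simp [Nat.mul_add_mod_of_lt j.is_lt]

/-! ### Row-major indexing of encoded matrices -/

/-- The row-major enumeration of an `n × n` table as `List.ofFn` over `Fin (n * n)`. [folklore] -/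
theorem flatMap_finRange_map_eq_ofFn {α : Type*} {n : ℕ} (h : Fin n → Fin n → α) :
    ((List.finRange n).flatMap fun i => (List.finRange n).map (h i)) =
      List.ofFn fun m : Fin (n * n) => h m.divNat m.modNat := by
  rw [List.ofFn_mul]
  change ((List.finRange n).map fun i => (List.finRange n).map (h i)).flatten = _
  rw [← List.ofFn_eq_map]
  congr 1
  refine congrArg List.ofFn (funext fun i => ?_)
  rw [← List.ofFn_eq_map]
  refine congrArg List.ofFn (funext fun j => ?_)
  rw [divNat_mk_mul_add, modNat_mk_mul_add]

/-- The encoding of an `N × N` weight matrix is `N` followed by the row-major list of the codes. [folklore] -/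
theorem encodeMatrixWithTop_eq_cons_ofFn {N : ℕ} (G : Matrix (Fin N) (Fin N) (WithTop ℤ)) :
    encodeMatrixWithTop G =
      N :: List.ofFn fun m : Fin (N * N) => encodeWithTopInt (G m.divNat m.modNat) := by
  unfold encodeMatrixWithTop
  rw [flatMap_finRange_map_eq_ofFn]

/-- Word `1 + m` of the encoding of `G` is the code of the entry `(m / N, m % N)`. [folklore] -/
theorem getElem_encodeMatrixWithTop_succ {N : ℕ} (G : Matrix (Fin N) (Fin N) (WithTop ℤ)) (m : ℕ)
    (hm : m < N * N) (h : m + 1 < (encodeMatrixWithTop G).length) :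
    (encodeMatrixWithTop G)[m + 1] =
      encodeWithTopInt (G (Fin.divNat ⟨m, hm⟩) (Fin.modNat ⟨m, hm⟩)) := by
  simp only [encodeMatrixWithTop_eq_cons_ofFn, List.getElem_cons_succ, List.getElem_ofFn]

/-- Word `0` of the encoding is `N`. [folklore] -/
theorem getElem_encodeMatrixWithTop_zero {N : ℕ} (G : Matrix (Fin N) (Fin N) (WithTop ℤ))
    (h : 0 < (encodeMatrixWithTop G).length) : (encodeMatrixWithTop G)[0] = N := by
  simp only [encodeMatrixWithTop_eq_cons_ofFn, List.getElem_cons_zero]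

/-! ### Codes of finite weights are positive; parity detects the sign -/

/-- Codes of finite weights are positive (`z ↦ encodeInt z + 1`). [folklore] -/
theorem encodeWithTopInt_coe_pos (z : ℤ) : 0 < encodeWithTopInt (z : WithTop ℤ) :=
  Nat.succ_pos _

/-- Codes of finite weights are nonzero; `0` is the code of `⊤`. [folklore] -/
theorem encodeWithTopInt_coe_ne_zero (z : ℤ) : encodeWithTopInt (z : WithTop ℤ) ≠ 0 :=
  Nat.succ_ne_zero _

/-- The code of `a : ℤ ∪ {∞}` is nonzero and even iff `a` is a negative integer. [folklore] -/
theorem encodeWithTopInt_ne_zero_and_even_iff (a : WithTop ℤ) :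
    (encodeWithTopInt a ≠ 0 ∧ encodeWithTopInt a % 2 = 0) ↔ a < 0 := by
  cases a with
  | top => simp [encodeWithTopInt]
  | coe z =>
    show (encodeInt z + 1 ≠ 0 ∧ (encodeInt z + 1) % 2 = 0) ↔ (z : WithTop ℤ) < 0
    rw [WithTop.coe_lt_zero]
    cases z with
    | ofNat m => simp
    | negSucc m =>
      simp only [encodeInt_negSucc, ne_eq, Nat.add_eq_zero_iff, one_ne_zero, and_false,
        not_false_eq_true, true_and, Int.negSucc_lt_zero, iff_true]
      omega


/-! ### Generic one-step lemmas in configuration form -/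

section Steps

variable {P : Program} {w : ℕ} {O : List ℕ → List ℕ} {ρ : ℕ → ℕ} {i : ℕ} {mem : ℕ → ℕ}
  {cp : ℕ} {qs : List (List ℕ)}

/-- One `op` step with a direct destination, in configuration form (`WordRAM.step_op`). [folklore] -/
theorem step_op_dir {o : BinOp} {a : ℕ} {x y : Operand} (h : P[i]? = some (.op o (.dir a) x y)) :
    step P w O ρ ⟨some i, mem, cp, qs⟩ =
      some ⟨some (i + 1), Function.update mem a (o.eval w (x.read mem) (y.read mem)), cp, qs⟩ :=
  step_op rfl h

/-- One `op` step with an indirect destination, in configuration form (`WordRAM.step_op`). [folklore] -/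
theorem step_op_ind {o : BinOp} {a : ℕ} {x y : Operand} (h : P[i]? = some (.op o (.ind a) x y)) :
    step P w O ρ ⟨some i, mem, cp, qs⟩ =
      some ⟨some (i + 1), Function.update mem (mem a) (o.eval w (x.read mem) (y.read mem)), cp, qs⟩ :=
  step_op rfl h

/-- One `jmp` step in configuration form (`WordRAM.step_jmp`). [folklore] -/
theorem step_jmp' {t : ℕ} (h : P[i]? = some (.jmp t)) :
    step P w O ρ ⟨some i, mem, cp, qs⟩ = some ⟨some t, mem, cp, qs⟩ :=
  step_jmp rfl h

/-- One `jz` step on a zero test word: the jump is taken (`WordRAM.step_jz_zero`). [folklore] -/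
theorem step_jz_taken {x : Operand} {t : ℕ} (h : P[i]? = some (.jz x t)) (hx : x.read mem = 0) :
    step P w O ρ ⟨some i, mem, cp, qs⟩ = some ⟨some t, mem, cp, qs⟩ :=
  step_jz_zero rfl h hx

/-- One `jz` step on a nonzero test word: fall through (`WordRAM.step_jz_ne`). [folklore] -/
theorem step_jz_fall {x : Operand} {t : ℕ} (h : P[i]? = some (.jz x t)) (hx : x.read mem ≠ 0) :
    step P w O ρ ⟨some i, mem, cp, qs⟩ = some ⟨some (i + 1), mem, cp, qs⟩ :=
  step_jz_ne rfl h hx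

/-- One `halt` step in configuration form (`WordRAM.step_halt`). [folklore] -/
theorem step_halt' (h : P[i]? = some .halt) :
    step P w O ρ ⟨some i, mem, cp, qs⟩ = some ⟨none, mem, cp, qs⟩ :=
  step_halt rfl h

end Steps

/-- Evaluation of the binary operations without overflow. [folklore] -/
theorem eval_add {w x y : ℕ} (h : x + y < 2 ^ w) : BinOp.eval w .add x y = x + y := Nat.mod_eq_of_lt h
/-- Subtraction without underflow: `x - y` when `y ≤ x < 2 ^ w`. [folklore] -/
theorem eval_sub {w x y : ℕ} (hyx : y ≤ x) (hx : x < 2 ^ w) : BinOp.eval w .sub x y = x - y := by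
  show (x + 2 ^ w - y % 2 ^ w) % 2 ^ w = x - y
  rw [Nat.mod_eq_of_lt (lt_of_le_of_lt hyx hx), show x + 2 ^ w - y = (x - y) + 2 ^ w by omega,
    Nat.add_mod_right, Nat.mod_eq_of_lt (lt_of_le_of_lt (Nat.sub_le x y) hx)]
/-- Multiplication without overflow. [folklore] -/
theorem eval_mul {w x y : ℕ} (h : x * y < 2 ^ w) : BinOp.eval w .mul x y = x * y := Nat.mod_eq_of_lt h
/-- The comparison `lt` returns the word `[x < y]`. [folklore] -/
theorem eval_lt {w x y : ℕ} : BinOp.eval w .lt x y = if x < y then 1 else 0 := rfl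
/-- The comparison `eq` returns the word `[x = y]`. [folklore] -/
theorem eval_eq {w x y : ℕ} : BinOp.eval w .eq x y = if x = y then 1 else 0 := rfl
/-- Bitwise `or` without overflow. [folklore] -/
theorem eval_bor {w x y : ℕ} (h : x ||| y < 2 ^ w) : BinOp.eval w .bor x y = x ||| y := Nat.mod_eq_of_lt h

/-! ### The setting: a Negative Triangle instance and its input encoding -/

section Setting

variable {n : ℕ} (W : Matrix (Fin n) (Fin n) ℤ)

/-- The input word list. [folklore] -/
def inp : List ℕ := encodeMatrixWithTop (W.map ((↑) : ℤ → WithTop ℤ))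

/-- The code of the `t`-th matrix entry in row-major order (`0` beyond the matrix). [folklore] -/
def code (t : ℕ) : ℕ :=
  if h : t < n * n then
    encodeWithTopInt ((W (Fin.divNat ⟨t, h⟩) (Fin.modNat ⟨t, h⟩) : ℤ) : WithTop ℤ)
  else 0

/-- The input has `n² + 1` words. [folklore] -/
theorem inp_length : (inp W).length = n * n + 1 := by
  unfold inp; rw [encodeMatrixWithTop_length, sq]

/-- Word `0` of the input is `n`. [folklore] -/
theorem inp_getElem_zero (h : 0 < (inp W).length) : (inp W)[0] = n :=
  getElem_encodeMatrixWithTop_zero _ h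

/-- Word `t + 1` of the input is the code of the `t`-th entry. [folklore] -/
theorem inp_getElem_succ {t : ℕ} (ht : t < n * n) (h : t + 1 < (inp W).length) :
    (inp W)[t + 1] = code W t := by
  unfold inp; rw [getElem_encodeMatrixWithTop_succ _ t ht, code, dif_pos ht, Matrix.map_apply]

/-- Inside the matrix the codes are positive (all weights are finite). [folklore] -/
theorem code_pos {t : ℕ} (ht : t < n * n) : 0 < code W t := by
  rw [code, dif_pos ht]; exact encodeWithTopInt_coe_pos _

/-- Beyond the matrix `code W t = 0` (junk value, never read as an arc). [folklore] -/
theorem code_of_le {t : ℕ} (ht : n * n ≤ t) : code W t = 0 := by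
  rw [code, dif_neg (not_lt.2 ht)]

/-- Every code is an input word. [folklore] -/
theorem code_mem_inp {t : ℕ} (ht : t < n * n) : code W t ∈ inp W := by
  have h : t + 1 < (inp W).length := by rw [inp_length]; omega
  rw [← inp_getElem_succ W ht h]
  exact List.getElem_mem h

/-- Every code fits in `inputWidth` bits. [folklore] -/
theorem code_lt_two_pow_inputWidth (t : ℕ) : code W t < 2 ^ inputWidth (inp W) := by
  by_cases ht : t < n * n
  · exact lt_two_pow_inputWidth_of_mem _ _ (code_mem_inp W ht)
  · rw [code_of_le W (not_lt.1 ht)]; exact Nat.two_pow_pos _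

/-- `n` fits in `inputWidth` bits (it is the first input word). [folklore] -/
theorem n_lt_two_pow_inputWidth : n < 2 ^ inputWidth (inp W) := by
  have h : 0 < (inp W).length := by rw [inp_length]; omega
  have := List.getElem_mem h
  rw [inp_getElem_zero W h] at this
  exact lt_two_pow_inputWidth_of_mem _ _ this

/-- `n² + 1` fits in `inputWidth` bits (it is the input length). [folklore] -/
theorem nn_lt_two_pow_inputWidth : n * n + 1 < 2 ^ inputWidth (inp W) := by
  rw [← inp_length W]; exact length_lt_two_pow_inputWidth _

/-! ### The initial memory -/

variable {w : ℕ} (hw : inputWidth (inp W) ≤ w)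
include hw

/-- `2 ^ inputWidth ≤ 2 ^ w` for word sizes `w ≥ inputWidth`. [folklore] -/
theorem two_pow_inputWidth_le : 2 ^ inputWidth (inp W) ≤ 2 ^ w := Nat.pow_le_pow_right Nat.two_pos hw

/-- Every code is a `w`-bit word. [folklore] -/
theorem code_lt (t : ℕ) : code W t < 2 ^ w :=
  lt_of_lt_of_le (code_lt_two_pow_inputWidth W t) (two_pow_inputWidth_le W hw)

/-- Initially cell `0` holds the input length `n² + 1` (no truncation at word size `w`). [folklore] -/
theorem init_mem_0 : (init w (inp W)).mem 0 = n * n + 1 := by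
  rw [init_mem_zero_of_inputWidth_le hw, inp_length]

/-- Initially cell `1` holds `n`. [folklore] -/
theorem init_mem_1 : (init w (inp W)).mem 1 = n := by
  have h : 0 < (inp W).length := by rw [inp_length]; omega
  rw [init_mem_succ w (inp W) 0 h, inp_getElem_zero W h]
  exact Nat.mod_eq_of_lt (lt_of_lt_of_le (n_lt_two_pow_inputWidth W) (two_pow_inputWidth_le W hw))

/-- Initially cell `t + 2` holds the code of the `t`-th entry. [folklore] -/
theorem init_mem_add_two {t : ℕ} (ht : t < n * n) : (init w (inp W)).mem (t + 2) = code W t := by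
  have h : t + 1 < (inp W).length := by rw [inp_length]; omega
  rw [init_mem_succ w (inp W) (t + 1) h, inp_getElem_succ W ht h]
  exact Nat.mod_eq_of_lt (code_lt W hw t)

omit hw in
/-- Initially every cell beyond the input is `0`. [folklore] -/
theorem init_mem_of_lt {a : ℕ} (ha : n * n + 1 < a) : (init w (inp W)).mem a = 0 :=
  init_mem_of_length_lt w (inp W) a (by rw [inp_length]; exact ha)

end Setting

/-! ### Phase 1: the bootstrap loop -/

/-- The far base address `F = n² + 33`. [folklore] -/
def F (n : ℕ) : ℕ := n * n + 33

/-- The bound on all "small" values (addresses, counters, products) held in registers. [folklore] -/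
def bnd (n : ℕ) : ℕ := 40 * (n * n + 2)

section Boot

variable {n : ℕ} (W : Matrix (Fin n) (Fin n) ℤ) {w : ℕ} (hw : inputWidth (inp W) ≤ w)
  (hB : bnd n ≤ 2 ^ w) {O : List ℕ → List ℕ} {ρ : ℕ → ℕ}

/-- Memory at the head of the bootstrap loop after `t` iterations. [folklore] -/
def bootMem (w t : ℕ) : ℕ → ℕ := fun a =>
  if a = 0 then F n + 1 + t else if a = 1 then t + 2 else if a = F n then n
  else if F n + 1 ≤ a ∧ a < F n + 1 + t then code W (a - (F n + 1)) else (init w (inp W)).mem a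

/-- During the bootstrap, cell `0` is the destination pointer `F + 1 + t`. [folklore] -/
theorem bootMem_apply_zero (t : ℕ) : bootMem W w t 0 = F n + 1 + t := by simp [bootMem]

/-- During the bootstrap, cell `1` is the source pointer `t + 2`. [folklore] -/
theorem bootMem_apply_one (t : ℕ) : bootMem W w t 1 = t + 2 := by simp [bootMem]

/-- During the bootstrap, cell `F` holds `n`. [folklore] -/
theorem bootMem_apply_F (t : ℕ) : bootMem W w t (F n) = n := by
  have h0 : F n ≠ 0 := by unfold F; omega
  have h1 : F n ≠ 1 := by unfold F; omega
  simp [bootMem, h0, h1]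

/-- After `t` iterations the first `t` codes have been copied to `F + 1, …, F + t`. [folklore] -/
theorem bootMem_apply_far {t s : ℕ} (hs : s < t) : bootMem W w t (F n + 1 + s) = code W s := by
  unfold bootMem F at *
  have h0 : n * n + 33 + 1 + s ≠ 0 := by omega
  have h1 : n * n + 33 + 1 + s ≠ 1 := by omega
  have h2 : n * n + 33 + 1 + s ≠ n * n + 33 := by omega
  simp only [h0, h1, h2, if_false]
  rw [if_pos (by omega)]
  congr 1
  omega

/-- The bootstrap does not touch the cells `2 ≤ a < F` (the input codes). [folklore] -/
theorem bootMem_apply_low {t a : ℕ} (h2 : 2 ≤ a) (ha : a < F n) : bootMem W w t a = (init w (inp W)).mem a := by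
  unfold bootMem
  have h0 : a ≠ 0 := by omega
  have h1 : a ≠ 1 := by omega
  have hF : a ≠ F n := by omega
  have hr : ¬ (F n + 1 ≤ a ∧ a < F n + 1 + t) := by omega
  simp only [h0, h1, hF, hr, if_false]

/-- The bootstrap has not yet touched the cells from `F + 1 + t` on. [folklore] -/
theorem bootMem_apply_high {t a : ℕ} (ha : F n + 1 + t ≤ a) : bootMem W w t a = (init w (inp W)).mem a := by
  unfold bootMem
  unfold F at *
  have h0 : a ≠ 0 := by omega
  have h1 : a ≠ 1 := by omega
  have hF : a ≠ n * n + 33 := by omega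
  have hr : ¬ (n * n + 33 + 1 ≤ a ∧ a < n * n + 33 + 1 + t) := by omega
  simp only [h0, h1, hF, hr, if_false]

include hw in
/-- The next source cell `t + 2` still holds the code of entry `t`. [folklore] -/
theorem bootMem_apply_src {t : ℕ} (ht : t < n * n) : bootMem W w t (t + 2) = code W t := by
  rw [bootMem_apply_low W (by omega) (by unfold F; omega)]
  exact init_mem_add_two W hw ht

/-- After `n²` iterations the source pointer reaches the first zero cell `n² + 2` (loop exit). [folklore] -/
theorem bootMem_apply_src_end : bootMem W w (n * n) (n * n + 2) = 0 := by
  rw [bootMem_apply_low W (by omega) (by unfold F; omega)]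
  exact init_mem_of_lt W (by omega)

include hB in
/-- All bootstrap addresses are `w`-bit words. [folklore] -/
theorem F_lt : F n + 1 + n * n + 2 < 2 ^ w := by
  unfold F; unfold bnd at hB; omega

include hw hB in
/-- The four straight-line instructions before the loop. [folklore] -/
theorem run_boot_pre :
    run prog w O ρ 4 (init w (inp W)) = some ⟨some 4, bootMem W w 0, 0, []⟩ := by
  have hFw := F_lt (n := n) hB
  have hn := Nat.le_mul_self n
  have h0 := init_mem_0 W hw
  have h1 := init_mem_1 W hw
  set M0 := (init w (inp W)).mem with hM0
  have e0 : step prog w O ρ (init w (inp W)) = some ⟨some 1, Function.update M0 0 (F n), 0, []⟩ := by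
    show step prog w O ρ ⟨some 0, M0, 0, []⟩ = _
    rw [step_op_dir (by rfl)]
    simp only [Operand.read_dir, Operand.read_imm, h0]
    rw [eval_add (show n * n + 1 + 32 < 2 ^ w by unfold F at hFw; omega)]
    rfl
  set M1 := Function.update M0 0 (F n) with hM1
  have hM1_0 : M1 0 = F n := by simp [hM1]
  have hM1_1 : M1 1 = n := by rw [hM1, Function.update_of_ne (by norm_num), h1]
  have e1 : step prog w O ρ ⟨some 1, M1, 0, []⟩ = some ⟨some 2, Function.update M1 (F n) n, 0, []⟩ := by
    rw [step_op_ind (by rfl)]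
    simp only [Operand.read_dir, Operand.read_imm, hM1_0, hM1_1]
    rw [eval_add (show n + 0 < 2 ^ w by unfold F at hFw; omega)]
    rfl
  set M2 := Function.update M1 (F n) n with hM2
  have hF0 : F n ≠ 0 := by unfold F; omega
  have hF1 : F n ≠ 1 := by unfold F; omega
  have hM2_0 : M2 0 = F n := by rw [hM2, Function.update_of_ne hF0.symm, hM1_0]
  have e2 : step prog w O ρ ⟨some 2, M2, 0, []⟩ = some ⟨some 3, Function.update M2 0 (F n + 1), 0, []⟩ := by
    rw [step_op_dir (by rfl)]
    simp only [Operand.read_dir, Operand.read_imm, hM2_0]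
    rw [eval_add (show F n + 1 < 2 ^ w by omega)]
  set M3 := Function.update M2 0 (F n + 1) with hM3
  have e3 : step prog w O ρ ⟨some 3, M3, 0, []⟩ = some ⟨some 4, Function.update M3 1 2, 0, []⟩ := by
    rw [step_op_dir (by rfl)]
    simp only [Operand.read_imm]
    rw [eval_add (show 2 + 0 < 2 ^ w by omega)]
  rw [run_succ_of_step _ _ _ _ e0, run_succ_of_step _ _ _ _ e1, run_succ_of_step _ _ _ _ e2,
    run_succ_of_step _ _ _ _ e3, run_zero]
  congr 2
  funext a
  simp only [hM3, hM2, hM1, Function.update_apply]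
  unfold bootMem
  by_cases ha1 : a = 1
  · subst ha1; simp
  by_cases ha0 : a = 0
  · subst ha0; simp
  by_cases haF : a = F n
  · subst haF; simp [hF0, hF1]
  simp only [ha1, ha0, haF, ↓reduceIte]
  split_ifs with h5
  · exfalso; omega
  · rfl

include hw hB in
/-- One iteration of the bootstrap loop: copy `code t` to the far region. [folklore] -/
theorem run_boot_iter {t : ℕ} (ht : t < n * n) :
    run prog w O ρ 5 ⟨some 4, bootMem W w t, 0, []⟩ = some ⟨some 4, bootMem W w (t + 1), 0, []⟩ := by
  have hFw := F_lt (n := n) hB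
  set M := bootMem W w t with hM
  have hM0 : M 0 = F n + 1 + t := bootMem_apply_zero W t
  have hM1 : M 1 = t + 2 := bootMem_apply_one W t
  have hsrc : M (t + 2) = code W t := bootMem_apply_src W hw ht
  have hcode := code_pos W ht
  have hcw := code_lt W hw t
  have e4 : step prog w O ρ ⟨some 4, M, 0, []⟩ = some ⟨some 5, M, 0, []⟩ := by
    apply step_jz_fall (by rfl)
    simp only [Operand.read_ind, hM1, hsrc]
    exact hcode.ne'
  have e5 : step prog w O ρ ⟨some 5, M, 0, []⟩ =
      some ⟨some 6, Function.update M (F n + 1 + t) (code W t), 0, []⟩ := by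
    rw [step_op_ind (by rfl)]
    simp only [Operand.read_ind, Operand.read_imm, hM0, hM1, hsrc]
    rw [eval_add (show code W t + 0 < 2 ^ w by omega)]
    rfl
  set M5 := Function.update M (F n + 1 + t) (code W t) with hM5
  have hM5_0 : M5 0 = F n + 1 + t := by
    rw [hM5, Function.update_of_ne (by unfold F; omega), hM0]
  have e6 : step prog w O ρ ⟨some 6, M5, 0, []⟩ =
      some ⟨some 7, Function.update M5 0 (F n + 1 + t + 1), 0, []⟩ := by
    rw [step_op_dir (by rfl)]
    simp only [Operand.read_dir, Operand.read_imm, hM5_0]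
    rw [eval_add (show F n + 1 + t + 1 < 2 ^ w by unfold F at hFw ⊢; omega)]
  set M6 := Function.update M5 0 (F n + 1 + t + 1) with hM6
  have hM6_1 : M6 1 = t + 2 := by
    rw [hM6, Function.update_of_ne (by norm_num), hM5, Function.update_of_ne (by unfold F; omega), hM1]
  have e7 : step prog w O ρ ⟨some 7, M6, 0, []⟩ =
      some ⟨some 8, Function.update M6 1 (t + 2 + 1), 0, []⟩ := by
    rw [step_op_dir (by rfl)]
    simp only [Operand.read_dir, Operand.read_imm, hM6_1]
    rw [eval_add (show t + 2 + 1 < 2 ^ w by unfold F at hFw; omega)]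
  set M7 := Function.update M6 1 (t + 2 + 1) with hM7
  have e8 : step prog w O ρ ⟨some 8, M7, 0, []⟩ = some ⟨some 4, M7, 0, []⟩ := step_jmp' (by rfl)
  rw [run_succ_of_step _ _ _ _ e4, run_succ_of_step _ _ _ _ e5, run_succ_of_step _ _ _ _ e6,
    run_succ_of_step _ _ _ _ e7, run_succ_of_step _ _ _ _ e8, run_zero]
  congr 2
  funext a
  simp only [hM7, hM6, hM5, Function.update_apply]
  by_cases ha1 : a = 1
  · subst ha1; simp [bootMem_apply_one]
  by_cases ha0 : a = 0
  · subst ha0; simp only [↓reduceIte, if_neg one_ne_zero.symm, bootMem_apply_zero]; omega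
  by_cases haF : a = F n + 1 + t
  · subst haF
    simp only [ha1, ha0, ↓reduceIte]
    exact (bootMem_apply_far W (Nat.lt_succ_self t)).symm
  simp only [ha1, ha0, haF, ↓reduceIte, hM]
  unfold bootMem
  simp only [ha1, ha0, ↓reduceIte]
  by_cases hF' : a = F n
  · simp [hF']
  simp only [hF', ↓reduceIte]
  by_cases hr : F n + 1 ≤ a ∧ a < F n + 1 + t
  · rw [if_pos hr, if_pos (by omega)]
  · rw [if_neg hr, if_neg (by omega)]

/-- The exit test of the bootstrap loop (the first zero cell after the input). [folklore] -/
theorem run_boot_exit :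
    run prog w O ρ 1 ⟨some 4, bootMem W w (n * n), 0, []⟩ = some ⟨some 9, bootMem W w (n * n), 0, []⟩ := by
  rw [run_one]
  apply step_jz_taken (by rfl)
  simp only [Operand.read_ind, bootMem_apply_one, bootMem_apply_src_end]

include hw hB in
/-- The bootstrap loop after `t` iterations. [folklore] -/
theorem run_boot_loop (t : ℕ) (ht : t ≤ n * n) :
    run prog w O ρ (4 + 5 * t) (init w (inp W)) = some ⟨some 4, bootMem W w t, 0, []⟩ := by
  induction t with
  | zero => simpa using run_boot_pre W hw hB
  | succ t ih =>
    rw [show 4 + 5 * (t + 1) = (4 + 5 * t) + 5 by ring]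
    exact run_add_of_run _ _ _ _ (ih (by omega)) (run_boot_iter W hw hB (by omega))

include hw hB in
/-- **Phase 1.** After `5 n² + 5` steps the matrix is copied to the far region and control is at
the setup code (`pc = 9`). [folklore] -/
theorem run_boot :
    run prog w O ρ (5 * (n * n) + 5) (init w (inp W)) = some ⟨some 9, bootMem W w (n * n), 0, []⟩ := by
  rw [show 5 * (n * n) + 5 = (4 + 5 * (n * n)) + 1 by ring]
  exact run_add_of_run _ _ _ _ (run_boot_loop W hw hB _ le_rfl) (run_boot_exit W)

end Boot

/-! ### Registers below address 21, heap above: the normal form of memory after the bootstrap -/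

/-- Memory assembled from a register file `R` (cells `< 21`) and a heap `H` (cells `≥ 21`). [folklore] -/
def mkMem (R H : ℕ → ℕ) : ℕ → ℕ := fun a => if a < 21 then R a else H a

/-- Reading a cell of `mkMem R H`. [folklore] -/
theorem mkMem_apply (R H : ℕ → ℕ) (a : ℕ) : mkMem R H a = if a < 21 then R a else H a := rfl

/-- Cells `≥ 21` of `mkMem R H` are heap cells. [folklore] -/
theorem mkMem_ge (R H : ℕ → ℕ) {a : ℕ} (ha : 21 ≤ a) : mkMem R H a = H a := if_neg (by omega)

/-- `mkMem M M = M`: any memory splits into its own registers and heap. [folklore] -/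
theorem mkMem_self (M : ℕ → ℕ) : mkMem M M = M := by
  funext a; unfold mkMem; split_ifs <;> rfl

/-- Writing a register (cell `< 21`) of `mkMem R H` updates `R`. [folklore] -/
theorem update_mkMem_lt (R H : ℕ → ℕ) {a : ℕ} (v : ℕ) (ha : a < 21) :
    Function.update (mkMem R H) a v = mkMem (Function.update R a v) H := by
  funext b
  by_cases hb : b = a
  · subst hb; simp [mkMem, ha]
  · rw [Function.update_of_ne hb]; unfold mkMem; rw [Function.update_of_ne hb]

/-- Writing a heap cell (cell `≥ 21`) of `mkMem R H` updates `H`. [folklore] -/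
theorem update_mkMem_ge (R H : ℕ → ℕ) {a : ℕ} (v : ℕ) (ha : 21 ≤ a) :
    Function.update (mkMem R H) a v = mkMem R (Function.update H a v) := by
  funext b
  by_cases hb : b = a
  · subst hb; simp [mkMem]; omega
  · rw [Function.update_of_ne hb]; unfold mkMem; rw [Function.update_of_ne hb]

/-- Writing a segment into the heap of `mkMem R H` updates `H` (frame rule for oracle answers). [folklore] -/
theorem writeSeg_mkMem_ge (R : ℕ → ℕ) :
    ∀ (l : List ℕ) (H : ℕ → ℕ) {a : ℕ}, 21 ≤ a → writeSeg (mkMem R H) a l = mkMem R (writeSeg H a l)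
  | [], H, a, _ => rfl
  | v :: l, H, a, ha => by
      rw [writeSeg_cons, writeSeg_cons, update_mkMem_ge R H v ha, writeSeg_mkMem_ge R l _ (by omega)]

/-- Reading a heap segment of `mkMem R H` reads `H` (frame rule for oracle queries). [folklore] -/
theorem readSeg_mkMem_ge (R H : ℕ → ℕ) {a : ℕ} (ha : 21 ≤ a) (len : ℕ) :
    readSeg (mkMem R H) a len = readSeg H a len :=
  readSeg_congr fun j _ => mkMem_ge R H (by omega)


/-! ### Phase 2: setting up the registers -/

/-- Query segment base `Q = F + 1 + n²`. [folklore] -/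
def Q (n : ℕ) : ℕ := F n + 1 + n * n
/-- Query length `N² + 1`. [folklore] -/
def LEN (n : ℕ) : ℕ := 4 * n * (4 * n) + 1
/-- Answer base `A0 = Q + N² + 1`. [folklore] -/
def A0 (n : ℕ) : ℕ := Q n + LEN n
/-- Layer stride `S = n N + n` between the three arcs of one pair. [folklore] -/
def S (n : ℕ) : ℕ := n * (4 * n) + n

section Setup

variable {n : ℕ} (W : Matrix (Fin n) (Fin n) ℤ) {w : ℕ} (hw : inputWidth (inp W) ≤ w)
  (hB : bnd n ≤ 2 ^ w) {O : List ℕ → List ℕ} {ρ : ℕ → ℕ}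

/-- The registers that loop A relies on, with loop counter `t`. [folklore] -/
def RegsA (n : ℕ) (R : ℕ → ℕ) (t : ℕ) : Prop :=
  R 2 = n ∧ R 3 = 4 * n ∧ R 4 = n * n ∧ R 5 = F n + 1 ∧ R 6 = Q n ∧ R 7 = Q n + n + 1 ∧
    R 8 = S n ∧ R 9 = LEN n ∧ R 10 = A0 n ∧ R 11 = t

/-- The heap after the setup: the bootstrap memory with `N` written at `Q`. [folklore] -/
def heap0 (w : ℕ) : ℕ → ℕ := Function.update (bootMem W w (n * n)) (Q n) (4 * n)

include hB in
/-- **Phase 2.** The fifteen setup instructions. [folklore] -/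
theorem run_setup : ∃ R : ℕ → ℕ, RegsA n R 0 ∧
    run prog w O ρ 15 ⟨some 9, bootMem W w (n * n), 0, []⟩ = some ⟨some 24, mkMem R (heap0 W w), 0, []⟩ := by
  have hnn : n ≤ n * n := Nat.le_mul_self n
  have h4 : n * (4 * n) = 4 * (n * n) := by ring
  have h16 : 4 * n * (4 * n) = 16 * (n * n) := by ring
  have hbnd : bnd n = 40 * (n * n) + 80 := by unfold bnd; ring
  have hFn : F n = n * n + 33 := rfl
  have hQ : Q n = 2 * (n * n) + 34 := by unfold Q F; ring
  have hLEN : LEN n = 16 * (n * n) + 1 := by unfold LEN; ring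
  have hA0 : A0 n = 18 * (n * n) + 35 := by unfold A0 LEN Q F; ring
  have hF21 : ¬ (F n < 21) := by omega
  set B := bootMem W w (n * n) with hBdef
  have hB0 : B 0 = F n + 1 + n * n := bootMem_apply_zero W _
  have hB1 : B 1 = n * n + 2 := bootMem_apply_one W _
  have hBF : B (F n) = n := bootMem_apply_F W _
  have e9 : step prog w O ρ ⟨some 9, mkMem B B, 0, []⟩ =
      some ⟨some 10, mkMem (Function.update B 5 (F n + 1)) B, 0, []⟩ := by
    rw [step_op_dir (by rfl), update_mkMem_lt _ _ _ (by norm_num)]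
    simp only [mkMem_apply, Function.update_apply, Nat.reduceEqDiff, Nat.reduceLT, ↓reduceIte, hB0, hB1, hBF, hF21, Operand.read_dir, Operand.read_ind, Operand.read_imm]
    rw [eval_add (show n * n + 2 + 32 < 2 ^ w by omega)]
    rw [show n * n + 2 + 32 = F n + 1 by omega]
  set R10 : ℕ → ℕ := Function.update B 5 (F n + 1) with hR10
  have e10 : step prog w O ρ ⟨some 10, mkMem R10 B, 0, []⟩ =
      some ⟨some 11, mkMem (Function.update R10 4 (n * n)) B, 0, []⟩ := by
    rw [step_op_dir (by rfl), update_mkMem_lt _ _ _ (by norm_num)]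
    simp only [hR10, mkMem_apply, Function.update_apply, Nat.reduceEqDiff, Nat.reduceLT, ↓reduceIte, hB0, hB1, hBF, hF21, Operand.read_dir, Operand.read_ind, Operand.read_imm]
    rw [eval_sub (show 2 ≤ n * n + 2 by omega) (show n * n + 2 < 2 ^ w by omega)]
    rw [show n * n + 2 - 2 = n * n by omega]
  set R11 : ℕ → ℕ := Function.update R10 4 (n * n) with hR11
  have e11 : step prog w O ρ ⟨some 11, mkMem R11 B, 0, []⟩ =
      some ⟨some 12, mkMem (Function.update R11 1 (F n)) B, 0, []⟩ := by
    rw [step_op_dir (by rfl), update_mkMem_lt _ _ _ (by norm_num)]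
    simp only [hR10, hR11, mkMem_apply, Function.update_apply, Nat.reduceEqDiff, Nat.reduceLT, ↓reduceIte, hB0, hB1, hBF, hF21, Operand.read_dir, Operand.read_ind, Operand.read_imm]
    rw [eval_sub (show 1 ≤ F n + 1 by omega) (show F n + 1 < 2 ^ w by omega)]
    rw [show F n + 1 - 1 = F n by omega]
  set R12 : ℕ → ℕ := Function.update R11 1 (F n) with hR12
  have e12 : step prog w O ρ ⟨some 12, mkMem R12 B, 0, []⟩ =
      some ⟨some 13, mkMem (Function.update R12 2 (n)) B, 0, []⟩ := by
    rw [step_op_dir (by rfl), update_mkMem_lt _ _ _ (by norm_num)]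
    simp only [hR10, hR11, hR12, mkMem_apply, Function.update_apply, Nat.reduceEqDiff, Nat.reduceLT, ↓reduceIte, hB0, hB1, hBF, hF21, Operand.read_dir, Operand.read_ind, Operand.read_imm]
    rw [eval_add (show n + 0 < 2 ^ w by omega)]
    rfl
  set R13 : ℕ → ℕ := Function.update R12 2 (n) with hR13
  have e13 : step prog w O ρ ⟨some 13, mkMem R13 B, 0, []⟩ =
      some ⟨some 14, mkMem (Function.update R13 3 (4 * n)) B, 0, []⟩ := by
    rw [step_op_dir (by rfl), update_mkMem_lt _ _ _ (by norm_num)]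
    simp only [hR10, hR11, hR12, hR13, mkMem_apply, Function.update_apply, Nat.reduceEqDiff, Nat.reduceLT, ↓reduceIte, hB0, hB1, hBF, hF21, Operand.read_dir, Operand.read_ind, Operand.read_imm]
    rw [eval_mul (show n * 4 < 2 ^ w by omega)]
    rw [show n * 4 = 4 * n by ring]
  set R14 : ℕ → ℕ := Function.update R13 3 (4 * n) with hR14
  have e14 : step prog w O ρ ⟨some 14, mkMem R14 B, 0, []⟩ =
      some ⟨some 15, mkMem (Function.update R14 6 (Q n)) B, 0, []⟩ := by
    rw [step_op_dir (by rfl), update_mkMem_lt _ _ _ (by norm_num)]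
    simp only [hR10, hR11, hR12, hR13, hR14, mkMem_apply, Function.update_apply, Nat.reduceEqDiff, Nat.reduceLT, ↓reduceIte, hB0, hB1, hBF, hF21, Operand.read_dir, Operand.read_ind, Operand.read_imm]
    rw [eval_add (show F n + 1 + n * n + 0 < 2 ^ w by omega)]
    rfl
  set R15 : ℕ → ℕ := Function.update R14 6 (Q n) with hR15
  have e15 : step prog w O ρ ⟨some 15, mkMem R15 B, 0, []⟩ =
      some ⟨some 16, mkMem R15 (heap0 W w), 0, []⟩ := by
    rw [step_op_ind (by rfl)]
    simp only [hR10, hR11, hR12, hR13, hR14, hR15, mkMem_apply, Function.update_apply, Nat.reduceEqDiff, Nat.reduceLT, ↓reduceIte, hB0, hB1, hBF, hF21, Operand.read_dir, Operand.read_ind, Operand.read_imm]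
    rw [update_mkMem_ge _ _ _ (show 21 ≤ F n + 1 + n * n by omega),
      eval_add (show 4 * n + 0 < 2 ^ w by omega)]
    rfl
  have e16 : step prog w O ρ ⟨some 16, mkMem R15 (heap0 W w), 0, []⟩ =
      some ⟨some 17, mkMem (Function.update R15 7 (Q n + n)) (heap0 W w), 0, []⟩ := by
    rw [step_op_dir (by rfl), update_mkMem_lt _ _ _ (by norm_num)]
    simp only [hR10, hR11, hR12, hR13, hR14, hR15, mkMem_apply, Function.update_apply, Nat.reduceEqDiff, Nat.reduceLT, ↓reduceIte, hB0, hB1, hBF, hF21, Operand.read_dir, Operand.read_ind, Operand.read_imm]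
    rw [eval_add (show Q n + n < 2 ^ w by omega)]
  set R17 : ℕ → ℕ := Function.update R15 7 (Q n + n) with hR17
  have e17 : step prog w O ρ ⟨some 17, mkMem R17 (heap0 W w), 0, []⟩ =
      some ⟨some 18, mkMem (Function.update R17 7 (Q n + n + 1)) (heap0 W w), 0, []⟩ := by
    rw [step_op_dir (by rfl), update_mkMem_lt _ _ _ (by norm_num)]
    simp only [hR10, hR11, hR12, hR13, hR14, hR15, hR17, mkMem_apply, Function.update_apply, Nat.reduceEqDiff, Nat.reduceLT, ↓reduceIte, hB0, hB1, hBF, hF21, Operand.read_dir, Operand.read_ind, Operand.read_imm]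
    rw [eval_add (show Q n + n + 1 < 2 ^ w by omega)]
  set R18 : ℕ → ℕ := Function.update R17 7 (Q n + n + 1) with hR18
  have e18 : step prog w O ρ ⟨some 18, mkMem R18 (heap0 W w), 0, []⟩ =
      some ⟨some 19, mkMem (Function.update R18 8 (n * (4 * n))) (heap0 W w), 0, []⟩ := by
    rw [step_op_dir (by rfl), update_mkMem_lt _ _ _ (by norm_num)]
    simp only [hR10, hR11, hR12, hR13, hR14, hR15, hR17, hR18, mkMem_apply, Function.update_apply, Nat.reduceEqDiff, Nat.reduceLT, ↓reduceIte, hB0, hB1, hBF, hF21, Operand.read_dir, Operand.read_ind, Operand.read_imm]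
    rw [eval_mul (show n * (4 * n) < 2 ^ w by omega)]
  set R19 : ℕ → ℕ := Function.update R18 8 (n * (4 * n)) with hR19
  have e19 : step prog w O ρ ⟨some 19, mkMem R19 (heap0 W w), 0, []⟩ =
      some ⟨some 20, mkMem (Function.update R19 8 (S n)) (heap0 W w), 0, []⟩ := by
    rw [step_op_dir (by rfl), update_mkMem_lt _ _ _ (by norm_num)]
    simp only [hR10, hR11, hR12, hR13, hR14, hR15, hR17, hR18, hR19, mkMem_apply, Function.update_apply, Nat.reduceEqDiff, Nat.reduceLT, ↓reduceIte, hB0, hB1, hBF, hF21, Operand.read_dir, Operand.read_ind, Operand.read_imm]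
    rw [eval_add (show n * (4 * n) + n < 2 ^ w by omega)]
    rfl
  set R20 : ℕ → ℕ := Function.update R19 8 (S n) with hR20
  have e20 : step prog w O ρ ⟨some 20, mkMem R20 (heap0 W w), 0, []⟩ =
      some ⟨some 21, mkMem (Function.update R20 9 (4 * n * (4 * n))) (heap0 W w), 0, []⟩ := by
    rw [step_op_dir (by rfl), update_mkMem_lt _ _ _ (by norm_num)]
    simp only [hR10, hR11, hR12, hR13, hR14, hR15, hR17, hR18, hR19, hR20, mkMem_apply, Function.update_apply, Nat.reduceEqDiff, Nat.reduceLT, ↓reduceIte, hB0, hB1, hBF, hF21, Operand.read_dir, Operand.read_ind, Operand.read_imm]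
    rw [eval_mul (show 4 * n * (4 * n) < 2 ^ w by omega)]
  set R21 : ℕ → ℕ := Function.update R20 9 (4 * n * (4 * n)) with hR21
  have e21 : step prog w O ρ ⟨some 21, mkMem R21 (heap0 W w), 0, []⟩ =
      some ⟨some 22, mkMem (Function.update R21 9 (LEN n)) (heap0 W w), 0, []⟩ := by
    rw [step_op_dir (by rfl), update_mkMem_lt _ _ _ (by norm_num)]
    simp only [hR10, hR11, hR12, hR13, hR14, hR15, hR17, hR18, hR19, hR20, hR21, mkMem_apply, Function.update_apply, Nat.reduceEqDiff, Nat.reduceLT, ↓reduceIte, hB0, hB1, hBF, hF21, Operand.read_dir, Operand.read_ind, Operand.read_imm]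
    rw [eval_add (show 4 * n * (4 * n) + 1 < 2 ^ w by omega)]
    rfl
  set R22 : ℕ → ℕ := Function.update R21 9 (LEN n) with hR22
  have e22 : step prog w O ρ ⟨some 22, mkMem R22 (heap0 W w), 0, []⟩ =
      some ⟨some 23, mkMem (Function.update R22 10 (A0 n)) (heap0 W w), 0, []⟩ := by
    rw [step_op_dir (by rfl), update_mkMem_lt _ _ _ (by norm_num)]
    simp only [hR10, hR11, hR12, hR13, hR14, hR15, hR17, hR18, hR19, hR20, hR21, hR22, mkMem_apply, Function.update_apply, Nat.reduceEqDiff, Nat.reduceLT, ↓reduceIte, hB0, hB1, hBF, hF21, Operand.read_dir, Operand.read_ind, Operand.read_imm]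
    rw [eval_add (show Q n + LEN n < 2 ^ w by omega)]
    rfl
  set R23 : ℕ → ℕ := Function.update R22 10 (A0 n) with hR23
  have e23 : step prog w O ρ ⟨some 23, mkMem R23 (heap0 W w), 0, []⟩ =
      some ⟨some 24, mkMem (Function.update R23 11 (0)) (heap0 W w), 0, []⟩ := by
    rw [step_op_dir (by rfl), update_mkMem_lt _ _ _ (by norm_num)]
    simp only [hR10, hR11, hR12, hR13, hR14, hR15, hR17, hR18, hR19, hR20, hR21, hR22, hR23, mkMem_apply, Function.update_apply, Nat.reduceEqDiff, Nat.reduceLT, ↓reduceIte, hB0, hB1, hBF, hF21, Operand.read_dir, Operand.read_ind, Operand.read_imm]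
    rw [eval_add (show 0 + 0 < 2 ^ w by omega)]
  set R24 : ℕ → ℕ := Function.update R23 11 (0) with hR24
  refine ⟨R24, ?_, ?_⟩
  · refine ⟨?_, ?_, ?_, ?_, ?_, ?_, ?_, ?_, ?_, ?_⟩ <;>
      simp only [hR10, hR11, hR12, hR13, hR14, hR15, hR17, hR18, hR19, hR20, hR21, hR22, hR23, hR24, Function.update_apply, Nat.reduceEqDiff, ↓reduceIte]
  · rw [show (⟨some 9, B, 0, []⟩ : Cfg) = ⟨some 9, mkMem B B, 0, []⟩ by rw [mkMem_self]]
    rw [run_succ_of_step _ _ _ _ e9, run_succ_of_step _ _ _ _ e10, run_succ_of_step _ _ _ _ e11,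
      run_succ_of_step _ _ _ _ e12, run_succ_of_step _ _ _ _ e13, run_succ_of_step _ _ _ _ e14,
      run_succ_of_step _ _ _ _ e15, run_succ_of_step _ _ _ _ e16, run_succ_of_step _ _ _ _ e17,
      run_succ_of_step _ _ _ _ e18, run_succ_of_step _ _ _ _ e19, run_succ_of_step _ _ _ _ e20,
      run_succ_of_step _ _ _ _ e21, run_succ_of_step _ _ _ _ e22, run_succ_of_step _ _ _ _ e23, run_zero]

end Setup


/-! ### Phase 3: loop A — writing the layered triangle graph

Offsets `m < N²` of the query matrix (row-major, `N = 4 n`) decode as `m = u N + v` with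
`u = ℓu n + a`, `v = ℓv n + b`; the arc of pair `(a, b)` between layers `ℓ` and `ℓ + 1` sits at
`moff n t ℓ` where `t = a n + b`. -/

section LoopA

variable {n : ℕ} (W : Matrix (Fin n) (Fin n) ℤ) {w : ℕ}

/-- Layer of the source of offset `m`. [folklore] -/
def lu (n m : ℕ) : ℕ := m / (4 * n) / n
/-- Index of the source of offset `m`. [folklore] -/
def ia (n m : ℕ) : ℕ := m / (4 * n) % n
/-- Layer of the target of offset `m`. [folklore] -/
def lv (n m : ℕ) : ℕ := m % (4 * n) / n
/-- Index of the target of offset `m`. [folklore] -/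
def jb (n m : ℕ) : ℕ := m % (4 * n) % n

/-- Offset `m` holds an arc that has been written after `t` iterations of loop A. [folklore] -/
def Written (n t m : ℕ) : Prop := lu n m + 1 = lv n m ∧ ia n m * n + jb n m < t

/-- Whether an offset has been written is decidable (needed to define the heap `heapA` by cases). [folklore] -/
instance (n t m : ℕ) : Decidable (Written n t m) := by unfold Written; infer_instance

/-- The offset of the arc from copy `ℓ` of `t / n` to copy `ℓ + 1` of `t % n`. [folklore] -/
def moff (n t ℓ : ℕ) : ℕ := (ℓ * n + t / n) * (4 * n) + ((ℓ + 1) * n + t % n)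

/-- The code written for the pair `(i, j)`: `0` (no arc) on the diagonal, else the weight code. [folklore] -/
def arcVal (i j : ℕ) : ℕ := if i = j then 0 else code W (i * n + j)

/-- `[i ≠ j]` as a word. [folklore] -/
def neq (i j : ℕ) : ℕ := if i = j then 0 else 1

/-- The heap after `t` iterations of loop A. [folklore] -/
def heapA (w t : ℕ) : ℕ → ℕ := fun addr =>
  if Q n + 1 ≤ addr ∧ addr < Q n + 1 + 4 * n * (4 * n) ∧ Written n t (addr - (Q n + 1)) then
    arcVal W (ia n (addr - (Q n + 1))) (jb n (addr - (Q n + 1)))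
  else heap0 W w addr

/-- Before loop A the heap is `heap0`. [folklore] -/
theorem heapA_zero : heapA W w 0 = heap0 W w := by
  funext a; unfold heapA Written; simp

/-- The two comparison instructions 28–29 compute the word `[i ≠ j]`. [folklore] -/
theorem neq_eq (i j : ℕ) : (if (if i = j then 1 else 0) = 0 then 1 else 0) = neq i j := by
  unfold neq; split_ifs <;> simp_all

/-- `[i ≠ j] ≤ 1`. [folklore] -/
theorem neq_le_one (i j : ℕ) : neq i j ≤ 1 := by unfold neq; split_ifs <;> simp

/-- Instruction 32: multiplying the code by `[i ≠ j]` yields the arc value (no arc on the diagonal). [folklore] -/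
theorem code_mul_neq (t : ℕ) : code W t * neq (t / n) (t % n) = arcVal W (t / n) (t % n) := by
  unfold neq arcVal
  split_ifs with h
  · simp
  · rw [Nat.mul_one, Nat.div_add_mod' t n]

/-- Arc values are bounded by the codes. [folklore] -/
theorem arcVal_le (i j : ℕ) : arcVal W i j ≤ code W (i * n + j) := by
  unfold arcVal; split_ifs <;> simp

/-- Decoding the offsets `moff`. [folklore] -/
theorem moff_decode {t ℓ : ℕ} (ht : t < n * n) (hℓ : ℓ ≤ 2) :
    moff n t ℓ < 4 * n * (4 * n) ∧ lu n (moff n t ℓ) = ℓ ∧ ia n (moff n t ℓ) = t / n ∧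
      lv n (moff n t ℓ) = ℓ + 1 ∧ jb n (moff n t ℓ) = t % n := by
  have hn : 0 < n := Nat.pos_of_ne_zero fun h => by subst h; simp at ht
  have hi : t / n < n := Nat.div_lt_of_lt_mul (by rwa [Nat.mul_comm] at ht ⊢)
  have hj : t % n < n := Nat.mod_lt t hn
  have hv : (ℓ + 1) * n + t % n < 4 * n := by nlinarith
  have hu : ℓ * n + t / n < 4 * n := by nlinarith
  have hdiv : moff n t ℓ / (4 * n) = ℓ * n + t / n := div_of_mul_add hv
  have hmod : moff n t ℓ % (4 * n) = (ℓ + 1) * n + t % n := Nat.mul_add_mod_of_lt hv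
  refine ⟨mul_add_lt_mul hu hv, ?_, ?_, ?_, ?_⟩
  · unfold lu; rw [hdiv]; exact div_of_mul_add hi
  · unfold ia; rw [hdiv]; exact Nat.mul_add_mod_of_lt hi
  · unfold lv; rw [hmod]; exact div_of_mul_add hj
  · unfold jb; rw [hmod]; exact Nat.mul_add_mod_of_lt hj

/-- Iteration `t + 1` of loop A writes exactly the arcs of the pair with row-major index `t`. [folklore] -/
theorem written_succ_iff (n t m : ℕ) :
    Written n (t + 1) m ↔ Written n t m ∨ (lu n m + 1 = lv n m ∧ ia n m * n + jb n m = t) := by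
  unfold Written; omega

/-- An offset whose arc is written exactly at iteration `t` is one of the three offsets `moff n t ℓ`. [folklore] -/
theorem eq_moff_of_written {t m : ℕ} (hn : 0 < n)
    (h1 : lu n m + 1 = lv n m) (h2 : ia n m * n + jb n m = t) :
    m = moff n t (lu n m) ∧ lu n m ≤ 2 := by
  have hN : 0 < 4 * n := by omega
  have hjb : jb n m < n := Nat.mod_lt _ hn
  have hi : t / n = ia n m := by rw [← h2]; exact div_of_mul_add hjb
  have hj : t % n = jb n m := by rw [← h2]; exact Nat.mul_add_mod_of_lt hjb
  have hvlt : m % (4 * n) < 4 * n := Nat.mod_lt _ hN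
  have hlv : lv n m < 4 := by
    unfold lv; exact Nat.div_lt_of_lt_mul (by omega)
  refine ⟨?_, by omega⟩
  unfold moff
  rw [hi, hj]
  have hu : m / (4 * n) = lu n m * n + ia n m := by
    unfold lu ia; rw [Nat.div_add_mod' (m / (4 * n)) n]
  have hv : m % (4 * n) = lv n m * n + jb n m := by
    unfold lv jb; rw [Nat.div_add_mod' (m % (4 * n)) n]
  calc m = m / (4 * n) * (4 * n) + m % (4 * n) := (Nat.div_add_mod' m (4 * n)).symm
    _ = (lu n m * n + ia n m) * (4 * n) + ((lu n m + 1) * n + jb n m) := by rw [hu, hv, ← h1]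

variable (hB : bnd n ≤ 2 ^ w)

/-- The far region is untouched by loop A. [folklore] -/
theorem heapA_far {t s : ℕ} (hs : s < n * n) : heapA W w t (F n + 1 + s) = code W s := by
  unfold heapA
  rw [if_neg (by unfold Q; omega)]
  unfold heap0
  rw [Function.update_of_ne (by unfold Q; omega)]
  exact bootMem_apply_far W hs

/-- The base cell of the query segment keeps `N`. [folklore] -/
theorem heapA_Q (t : ℕ) : heapA W w t (Q n) = 4 * n := by
  unfold heapA
  rw [if_neg (by omega)]
  unfold heap0
  rw [Function.update_self]

/-- **One iteration of loop A on the heap**: the three writes turn `heapA t` into `heapA (t + 1)`. [folklore] -/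
theorem heapA_succ {t : ℕ} (ht : t < n * n) :
    Function.update (Function.update (Function.update (heapA W w t)
      (Q n + 1 + moff n t 0) (arcVal W (t / n) (t % n)))
      (Q n + 1 + moff n t 1) (arcVal W (t / n) (t % n)))
      (Q n + 1 + moff n t 2) (arcVal W (t / n) (t % n)) = heapA W w (t + 1) := by
  have hn : 0 < n := Nat.pos_of_ne_zero fun h => by subst h; simp at ht
  obtain ⟨hm0, hlu0, hia0, hlv0, hjb0⟩ := moff_decode (n := n) ht (show 0 ≤ 2 by norm_num)
  obtain ⟨hm1, hlu1, hia1, hlv1, hjb1⟩ := moff_decode (n := n) ht (show 1 ≤ 2 by norm_num)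
  obtain ⟨hm2, hlu2, hia2, hlv2, hjb2⟩ := moff_decode (n := n) ht (show 2 ≤ 2 by norm_num)
  have ht' : t / n * n + t % n = t := Nat.div_add_mod' t n
  funext addr
  simp only [Function.update_apply]
  -- the three written cells
  by_cases h2 : addr = Q n + 1 + moff n t 2
  · subst h2
    rw [if_pos rfl]
    unfold heapA
    rw [Nat.add_sub_cancel_left,
      if_pos ⟨by omega, by omega, by unfold Written; rw [hlu2, hlv2, hia2, hjb2, ht']; omega⟩, hia2, hjb2]
  rw [if_neg h2]
  by_cases h1 : addr = Q n + 1 + moff n t 1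
  · subst h1
    rw [if_pos rfl]
    unfold heapA
    rw [Nat.add_sub_cancel_left,
      if_pos ⟨by omega, by omega, by unfold Written; rw [hlu1, hlv1, hia1, hjb1, ht']; omega⟩, hia1, hjb1]
  rw [if_neg h1]
  by_cases h0 : addr = Q n + 1 + moff n t 0
  · subst h0
    rw [if_pos rfl]
    unfold heapA
    rw [Nat.add_sub_cancel_left,
      if_pos ⟨by omega, by omega, by unfold Written; rw [hlu0, hlv0, hia0, hjb0, ht']; omega⟩, hia0, hjb0]
  rw [if_neg h0]
  -- any other cell is unchanged
  unfold heapA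
  by_cases hin : Q n + 1 ≤ addr ∧ addr < Q n + 1 + 4 * n * (4 * n)
  · obtain ⟨m, rfl⟩ : ∃ m, addr = Q n + 1 + m := ⟨addr - (Q n + 1), by omega⟩
    have hm : m < 4 * n * (4 * n) := by omega
    simp only [Nat.add_sub_cancel_left]
    by_cases hw' : Written n t m
    · rw [if_pos ⟨hin.1, hin.2, hw'⟩, if_pos ⟨hin.1, hin.2, (written_succ_iff n t m).2 (Or.inl hw')⟩]
    · rw [if_neg (fun h => hw' h.2.2)]
      by_cases hw1 : Written n (t + 1) m
      · exfalso
        rcases (written_succ_iff n t m).1 hw1 with h | ⟨hl, hij⟩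
        · exact hw' h
        obtain ⟨hmeq, hl2⟩ := eq_moff_of_written hn hl hij
        obtain h | h | h : lu n m = 0 ∨ lu n m = 1 ∨ lu n m = 2 := by omega
        · exact h0 (by rw [hmeq, h])
        · exact h1 (by rw [hmeq, h])
        · exact h2 (by rw [hmeq, h])
      · rw [if_neg (fun h => hw1 h.2.2)]
  · rw [if_neg (fun h => hin ⟨h.1, h.2.1⟩), if_neg (fun h => hin ⟨h.1, h.2.1⟩)]

end LoopA

section LoopARun

variable {n : ℕ} (W : Matrix (Fin n) (Fin n) ℤ) {w : ℕ} (hw : inputWidth (inp W) ≤ w)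
  (hB : bnd n ≤ 2 ^ w) {O : List ℕ → List ℕ} {ρ : ℕ → ℕ}

include hw hB in
/-- **One iteration of loop A** (nineteen instructions). [folklore] -/
theorem run_loopA_iter {R : ℕ → ℕ} {t : ℕ} (hR : RegsA n R t) (ht : t < n * n) :
    ∃ R' : ℕ → ℕ, RegsA n R' (t + 1) ∧
      run prog w O ρ 19 ⟨some 24, mkMem R (heapA W w t), 0, []⟩ =
        some ⟨some 24, mkMem R' (heapA W w (t + 1)), 0, []⟩ := by
  obtain ⟨hR2, hR3, hR4, hR5, hR6, hR7, hR8, hR9, hR10, hR11⟩ := hR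
  have hn : 0 < n := Nat.pos_of_ne_zero fun h => by subst h; simp at ht
  have hnn : n ≤ n * n := Nat.le_mul_self n
  have h4 : n * (4 * n) = 4 * (n * n) := by ring
  have h16 : 4 * n * (4 * n) = 16 * (n * n) := by ring
  have hbnd : bnd n = 40 * (n * n) + 80 := by unfold bnd; ring
  have hFn : F n = n * n + 33 := rfl
  have hQ : Q n = 2 * (n * n) + 34 := by unfold Q F; ring
  have hS : S n = 4 * (n * n) + n := by unfold S; ring
  have hdm : t / n * n ≤ t := Nat.div_mul_le_self t n
  have h4i : t / n * (4 * n) = 4 * (t / n * n) := by ring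
  have hj : t % n < n := Nat.mod_lt t hn
  have hcw : code W t < 2 ^ w := code_lt W hw t
  have hav : arcVal W (t / n) (t % n) < 2 ^ w := by
    refine lt_of_le_of_lt (arcVal_le W _ _) ?_
    rw [Nat.div_add_mod' t n]; exact hcw
  have hmul : code W t * neq (t / n) (t % n) < 2 ^ w :=
    lt_of_le_of_lt (by simpa using Nat.mul_le_mul_left (code W t) (neq_le_one (t / n) (t % n))) hcw
  have hlt31 : ¬ (F n + 1 + t < 21) := by omega
  have hfar : heapA W w t (F n + 1 + t) = code W t := heapA_far W ht
  have hp0 : t / n * (4 * n) + (Q n + n + 1) + t % n = Q n + 1 + moff n t 0 := by unfold moff; ring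
  have hp1 : Q n + 1 + moff n t 0 + S n = Q n + 1 + moff n t 1 := by unfold moff S; ring
  have hp2 : Q n + 1 + moff n t 1 + S n = Q n + 1 + moff n t 2 := by unfold moff S; ring
  set H := heapA W w t with hHdef
  have e24 : step prog w O ρ ⟨some 24, mkMem R H, 0, []⟩ =
      some ⟨some 25, mkMem (Function.update R 14 (1)) H, 0, []⟩ := by
    rw [step_op_dir (by rfl), update_mkMem_lt _ _ _ (by norm_num)]
    simp only [mkMem_apply, Function.update_apply, Nat.reduceEqDiff, Nat.reduceLT, ↓reduceIte, hR2, hR3, hR4, hR5, hR6, hR7, hR8, hR9, hR10, hR11, hlt31, hfar, Operand.read_dir, Operand.read_ind, Operand.read_imm]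
    rw [eval_lt, if_pos ht]
  set R25 : ℕ → ℕ := Function.update R 14 (1) with hR25
  have e25 : step prog w O ρ ⟨some 25, mkMem R25 H, 0, []⟩ = some ⟨some 26, mkMem R25 H, 0, []⟩ := by
    apply step_jz_fall (by rfl)
    simp [hR25, mkMem_apply, Function.update_apply]
  have e26 : step prog w O ρ ⟨some 26, mkMem R25 H, 0, []⟩ =
      some ⟨some 27, mkMem (Function.update R25 12 (t / n)) H, 0, []⟩ := by
    rw [step_op_dir (by rfl), update_mkMem_lt _ _ _ (by norm_num)]
    simp only [hR25, mkMem_apply, Function.update_apply, Nat.reduceEqDiff, Nat.reduceLT, ↓reduceIte, hR2, hR3, hR4, hR5, hR6, hR7, hR8, hR9, hR10, hR11, hlt31, hfar, Operand.read_dir, Operand.read_ind, Operand.read_imm]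
    rfl
  set R27 : ℕ → ℕ := Function.update R25 12 (t / n) with hR27
  have e27 : step prog w O ρ ⟨some 27, mkMem R27 H, 0, []⟩ =
      some ⟨some 28, mkMem (Function.update R27 13 (t % n)) H, 0, []⟩ := by
    rw [step_op_dir (by rfl), update_mkMem_lt _ _ _ (by norm_num)]
    simp only [hR25, hR27, mkMem_apply, Function.update_apply, Nat.reduceEqDiff, Nat.reduceLT, ↓reduceIte, hR2, hR3, hR4, hR5, hR6, hR7, hR8, hR9, hR10, hR11, hlt31, hfar, Operand.read_dir, Operand.read_ind, Operand.read_imm]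
    rfl
  set R28 : ℕ → ℕ := Function.update R27 13 (t % n) with hR28
  have e28 : step prog w O ρ ⟨some 28, mkMem R28 H, 0, []⟩ =
      some ⟨some 29, mkMem (Function.update R28 14 (if t / n = t % n then 1 else 0)) H, 0, []⟩ := by
    rw [step_op_dir (by rfl), update_mkMem_lt _ _ _ (by norm_num)]
    simp only [hR25, hR27, hR28, mkMem_apply, Function.update_apply, Nat.reduceEqDiff, Nat.reduceLT, ↓reduceIte, hR2, hR3, hR4, hR5, hR6, hR7, hR8, hR9, hR10, hR11, hlt31, hfar, Operand.read_dir, Operand.read_ind, Operand.read_imm]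
    rw [eval_eq]
  set R29 : ℕ → ℕ := Function.update R28 14 (if t / n = t % n then 1 else 0) with hR29
  have e29 : step prog w O ρ ⟨some 29, mkMem R29 H, 0, []⟩ =
      some ⟨some 30, mkMem (Function.update R29 14 (neq (t / n) (t % n))) H, 0, []⟩ := by
    rw [step_op_dir (by rfl), update_mkMem_lt _ _ _ (by norm_num)]
    simp only [hR25, hR27, hR28, hR29, mkMem_apply, Function.update_apply, Nat.reduceEqDiff, Nat.reduceLT, ↓reduceIte, hR2, hR3, hR4, hR5, hR6, hR7, hR8, hR9, hR10, hR11, hlt31, hfar, Operand.read_dir, Operand.read_ind, Operand.read_imm]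
    rw [eval_eq, neq_eq]
  set R30 : ℕ → ℕ := Function.update R29 14 (neq (t / n) (t % n)) with hR30
  have e30 : step prog w O ρ ⟨some 30, mkMem R30 H, 0, []⟩ =
      some ⟨some 31, mkMem (Function.update R30 16 (F n + 1 + t)) H, 0, []⟩ := by
    rw [step_op_dir (by rfl), update_mkMem_lt _ _ _ (by norm_num)]
    simp only [hR25, hR27, hR28, hR29, hR30, mkMem_apply, Function.update_apply, Nat.reduceEqDiff, Nat.reduceLT, ↓reduceIte, hR2, hR3, hR4, hR5, hR6, hR7, hR8, hR9, hR10, hR11, hlt31, hfar, Operand.read_dir, Operand.read_ind, Operand.read_imm]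
    rw [eval_add (show F n + 1 + t < 2 ^ w by omega)]
  set R31 : ℕ → ℕ := Function.update R30 16 (F n + 1 + t) with hR31
  have e31 : step prog w O ρ ⟨some 31, mkMem R31 H, 0, []⟩ =
      some ⟨some 32, mkMem (Function.update R31 15 (code W t)) H, 0, []⟩ := by
    rw [step_op_dir (by rfl), update_mkMem_lt _ _ _ (by norm_num)]
    simp only [hR25, hR27, hR28, hR29, hR30, hR31, mkMem_apply, Function.update_apply, Nat.reduceEqDiff, Nat.reduceLT, ↓reduceIte, hR2, hR3, hR4, hR5, hR6, hR7, hR8, hR9, hR10, hR11, hlt31, hfar, Operand.read_dir, Operand.read_ind, Operand.read_imm]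
    rw [eval_add (show code W t + 0 < 2 ^ w by omega)]
    rfl
  set R32 : ℕ → ℕ := Function.update R31 15 (code W t) with hR32
  have e32 : step prog w O ρ ⟨some 32, mkMem R32 H, 0, []⟩ =
      some ⟨some 33, mkMem (Function.update R32 15 (arcVal W (t / n) (t % n))) H, 0, []⟩ := by
    rw [step_op_dir (by rfl), update_mkMem_lt _ _ _ (by norm_num)]
    simp only [hR25, hR27, hR28, hR29, hR30, hR31, hR32, mkMem_apply, Function.update_apply, Nat.reduceEqDiff, Nat.reduceLT, ↓reduceIte, hR2, hR3, hR4, hR5, hR6, hR7, hR8, hR9, hR10, hR11, hlt31, hfar, Operand.read_dir, Operand.read_ind, Operand.read_imm]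
    rw [eval_mul hmul, code_mul_neq]
  set R33 : ℕ → ℕ := Function.update R32 15 (arcVal W (t / n) (t % n)) with hR33
  have e33 : step prog w O ρ ⟨some 33, mkMem R33 H, 0, []⟩ =
      some ⟨some 34, mkMem (Function.update R33 16 (t / n * (4 * n))) H, 0, []⟩ := by
    rw [step_op_dir (by rfl), update_mkMem_lt _ _ _ (by norm_num)]
    simp only [hR25, hR27, hR28, hR29, hR30, hR31, hR32, hR33, mkMem_apply, Function.update_apply, Nat.reduceEqDiff, Nat.reduceLT, ↓reduceIte, hR2, hR3, hR4, hR5, hR6, hR7, hR8, hR9, hR10, hR11, hlt31, hfar, Operand.read_dir, Operand.read_ind, Operand.read_imm]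
    rw [eval_mul (show t / n * (4 * n) < 2 ^ w by omega)]
  set R34 : ℕ → ℕ := Function.update R33 16 (t / n * (4 * n)) with hR34
  have e34 : step prog w O ρ ⟨some 34, mkMem R34 H, 0, []⟩ =
      some ⟨some 35, mkMem (Function.update R34 16 (t / n * (4 * n) + (Q n + n + 1))) H, 0, []⟩ := by
    rw [step_op_dir (by rfl), update_mkMem_lt _ _ _ (by norm_num)]
    simp only [hR25, hR27, hR28, hR29, hR30, hR31, hR32, hR33, hR34, mkMem_apply, Function.update_apply, Nat.reduceEqDiff, Nat.reduceLT, ↓reduceIte, hR2, hR3, hR4, hR5, hR6, hR7, hR8, hR9, hR10, hR11, hlt31, hfar, Operand.read_dir, Operand.read_ind, Operand.read_imm]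
    rw [eval_add (show t / n * (4 * n) + (Q n + n + 1) < 2 ^ w by omega)]
  set R35 : ℕ → ℕ := Function.update R34 16 (t / n * (4 * n) + (Q n + n + 1)) with hR35
  have e35 : step prog w O ρ ⟨some 35, mkMem R35 H, 0, []⟩ =
      some ⟨some 36, mkMem (Function.update R35 16 (t / n * (4 * n) + (Q n + n + 1) + t % n)) H, 0, []⟩ := by
    rw [step_op_dir (by rfl), update_mkMem_lt _ _ _ (by norm_num)]
    simp only [hR25, hR27, hR28, hR29, hR30, hR31, hR32, hR33, hR34, hR35, mkMem_apply, Function.update_apply, Nat.reduceEqDiff, Nat.reduceLT, ↓reduceIte, hR2, hR3, hR4, hR5, hR6, hR7, hR8, hR9, hR10, hR11, hlt31, hfar, Operand.read_dir, Operand.read_ind, Operand.read_imm]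
    rw [eval_add (show t / n * (4 * n) + (Q n + n + 1) + t % n < 2 ^ w by omega)]
  set R36 : ℕ → ℕ := Function.update R35 16 (t / n * (4 * n) + (Q n + n + 1) + t % n) with hR36
  have e36 : step prog w O ρ ⟨some 36, mkMem R36 H, 0, []⟩ =
      some ⟨some 37, mkMem R36 (Function.update H (t / n * (4 * n) + (Q n + n + 1) + t % n) (arcVal W (t / n) (t % n))), 0, []⟩ := by
    rw [step_op_ind (by rfl)]
    simp only [hR25, hR27, hR28, hR29, hR30, hR31, hR32, hR33, hR34, hR35, hR36, mkMem_apply, Function.update_apply, Nat.reduceEqDiff, Nat.reduceLT, ↓reduceIte, hR2, hR3, hR4, hR5, hR6, hR7, hR8, hR9, hR10, hR11, hlt31, hfar, Operand.read_dir, Operand.read_ind, Operand.read_imm]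
    rw [update_mkMem_ge _ _ _ (show 21 ≤ t / n * (4 * n) + (Q n + n + 1) + t % n by omega),
      eval_add (show arcVal W (t / n) (t % n) + 0 < 2 ^ w by omega)]
    rfl
  set H37 : ℕ → ℕ := Function.update H (t / n * (4 * n) + (Q n + n + 1) + t % n) (arcVal W (t / n) (t % n)) with hH37
  have e37 : step prog w O ρ ⟨some 37, mkMem R36 H37, 0, []⟩ =
      some ⟨some 38, mkMem (Function.update R36 16 (t / n * (4 * n) + (Q n + n + 1) + t % n + S n)) H37, 0, []⟩ := by
    rw [step_op_dir (by rfl), update_mkMem_lt _ _ _ (by norm_num)]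
    simp only [hR25, hR27, hR28, hR29, hR30, hR31, hR32, hR33, hR34, hR35, hR36, hH37, mkMem_apply, Function.update_apply, Nat.reduceEqDiff, Nat.reduceLT, ↓reduceIte, hR2, hR3, hR4, hR5, hR6, hR7, hR8, hR9, hR10, hR11, hlt31, hfar, Operand.read_dir, Operand.read_ind, Operand.read_imm]
    rw [eval_add (show t / n * (4 * n) + (Q n + n + 1) + t % n + S n < 2 ^ w by omega)]
  set R38 : ℕ → ℕ := Function.update R36 16 (t / n * (4 * n) + (Q n + n + 1) + t % n + S n) with hR38
  have e38 : step prog w O ρ ⟨some 38, mkMem R38 H37, 0, []⟩ =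
      some ⟨some 39, mkMem R38 (Function.update H37 (t / n * (4 * n) + (Q n + n + 1) + t % n + S n) (arcVal W (t / n) (t % n))), 0, []⟩ := by
    rw [step_op_ind (by rfl)]
    simp only [hR25, hR27, hR28, hR29, hR30, hR31, hR32, hR33, hR34, hR35, hR36, hR38, hH37, mkMem_apply, Function.update_apply, Nat.reduceEqDiff, Nat.reduceLT, ↓reduceIte, hR2, hR3, hR4, hR5, hR6, hR7, hR8, hR9, hR10, hR11, hlt31, hfar, Operand.read_dir, Operand.read_ind, Operand.read_imm]
    rw [update_mkMem_ge _ _ _ (show 21 ≤ t / n * (4 * n) + (Q n + n + 1) + t % n + S n by omega),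
      eval_add (show arcVal W (t / n) (t % n) + 0 < 2 ^ w by omega)]
    rfl
  set H39 : ℕ → ℕ := Function.update H37 (t / n * (4 * n) + (Q n + n + 1) + t % n + S n) (arcVal W (t / n) (t % n)) with hH39
  have e39 : step prog w O ρ ⟨some 39, mkMem R38 H39, 0, []⟩ =
      some ⟨some 40, mkMem (Function.update R38 16 (t / n * (4 * n) + (Q n + n + 1) + t % n + S n + S n)) H39, 0, []⟩ := by
    rw [step_op_dir (by rfl), update_mkMem_lt _ _ _ (by norm_num)]
    simp only [hR25, hR27, hR28, hR29, hR30, hR31, hR32, hR33, hR34, hR35, hR36, hR38, hH37, hH39, mkMem_apply, Function.update_apply, Nat.reduceEqDiff, Nat.reduceLT, ↓reduceIte, hR2, hR3, hR4, hR5, hR6, hR7, hR8, hR9, hR10, hR11, hlt31, hfar, Operand.read_dir, Operand.read_ind, Operand.read_imm]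
    rw [eval_add (show t / n * (4 * n) + (Q n + n + 1) + t % n + S n + S n < 2 ^ w by omega)]
  set R40 : ℕ → ℕ := Function.update R38 16 (t / n * (4 * n) + (Q n + n + 1) + t % n + S n + S n) with hR40
  have e40 : step prog w O ρ ⟨some 40, mkMem R40 H39, 0, []⟩ =
      some ⟨some 41, mkMem R40 (Function.update H39 (t / n * (4 * n) + (Q n + n + 1) + t % n + S n + S n) (arcVal W (t / n) (t % n))), 0, []⟩ := by
    rw [step_op_ind (by rfl)]
    simp only [hR25, hR27, hR28, hR29, hR30, hR31, hR32, hR33, hR34, hR35, hR36, hR38, hR40, hH37, hH39, mkMem_apply, Function.update_apply, Nat.reduceEqDiff, Nat.reduceLT, ↓reduceIte, hR2, hR3, hR4, hR5, hR6, hR7, hR8, hR9, hR10, hR11, hlt31, hfar, Operand.read_dir, Operand.read_ind, Operand.read_imm]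
    rw [update_mkMem_ge _ _ _ (show 21 ≤ t / n * (4 * n) + (Q n + n + 1) + t % n + S n + S n by omega),
      eval_add (show arcVal W (t / n) (t % n) + 0 < 2 ^ w by omega)]
    rfl
  set H41 : ℕ → ℕ := Function.update H39 (t / n * (4 * n) + (Q n + n + 1) + t % n + S n + S n) (arcVal W (t / n) (t % n)) with hH41
  have e41 : step prog w O ρ ⟨some 41, mkMem R40 H41, 0, []⟩ =
      some ⟨some 42, mkMem (Function.update R40 11 (t + 1)) H41, 0, []⟩ := by
    rw [step_op_dir (by rfl), update_mkMem_lt _ _ _ (by norm_num)]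
    simp only [hR25, hR27, hR28, hR29, hR30, hR31, hR32, hR33, hR34, hR35, hR36, hR38, hR40, hH37, hH39, hH41, mkMem_apply, Function.update_apply, Nat.reduceEqDiff, Nat.reduceLT, ↓reduceIte, hR2, hR3, hR4, hR5, hR6, hR7, hR8, hR9, hR10, hR11, hlt31, hfar, Operand.read_dir, Operand.read_ind, Operand.read_imm]
    rw [eval_add (show t + 1 < 2 ^ w by omega)]
  set R42 : ℕ → ℕ := Function.update R40 11 (t + 1) with hR42
  have e42 : step prog w O ρ ⟨some 42, mkMem R42 H41, 0, []⟩ = some ⟨some 24, mkMem R42 H41, 0, []⟩ :=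
    step_jmp' (by rfl)
  refine ⟨R42, ?_, ?_⟩
  · refine ⟨?_, ?_, ?_, ?_, ?_, ?_, ?_, ?_, ?_, ?_⟩ <;>
      simp only [hR25, hR27, hR28, hR29, hR30, hR31, hR32, hR33, hR34, hR35, hR36, hR38, hR40, hR42, Function.update_apply, Nat.reduceEqDiff, ↓reduceIte, hR2, hR3, hR4, hR5, hR6, hR7,
        hR8, hR9, hR10, hR11]
  · rw [run_succ_of_step _ _ _ _ e24, run_succ_of_step _ _ _ _ e25, run_succ_of_step _ _ _ _ e26,
      run_succ_of_step _ _ _ _ e27, run_succ_of_step _ _ _ _ e28, run_succ_of_step _ _ _ _ e29,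
      run_succ_of_step _ _ _ _ e30, run_succ_of_step _ _ _ _ e31, run_succ_of_step _ _ _ _ e32,
      run_succ_of_step _ _ _ _ e33, run_succ_of_step _ _ _ _ e34, run_succ_of_step _ _ _ _ e35,
      run_succ_of_step _ _ _ _ e36, run_succ_of_step _ _ _ _ e37, run_succ_of_step _ _ _ _ e38,
      run_succ_of_step _ _ _ _ e39, run_succ_of_step _ _ _ _ e40, run_succ_of_step _ _ _ _ e41,
      run_succ_of_step _ _ _ _ e42, run_zero]
    congr 3
    rw [hH41, hH39, hH37, hHdef, hp0, hp1, hp2]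
    exact heapA_succ W ht

end LoopARun

section LoopAWrap

variable {n : ℕ} (W : Matrix (Fin n) (Fin n) ℤ) {w : ℕ} (hw : inputWidth (inp W) ≤ w)
  (hB : bnd n ≤ 2 ^ w) {O : List ℕ → List ℕ} {ρ : ℕ → ℕ}

include hw hB in
/-- Loop A after `t` iterations. [folklore] -/
theorem run_loopA (t : ℕ) (ht : t ≤ n * n) {R : ℕ → ℕ} (hR : RegsA n R 0) :
    ∃ R' : ℕ → ℕ, RegsA n R' t ∧
      run prog w O ρ (19 * t) ⟨some 24, mkMem R (heap0 W w), 0, []⟩ =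
        some ⟨some 24, mkMem R' (heapA W w t), 0, []⟩ := by
  induction t with
  | zero => exact ⟨R, hR, by rw [heapA_zero]; rfl⟩
  | succ t ih =>
    obtain ⟨R₁, hR₁, h₁⟩ := ih (by omega)
    obtain ⟨R₂, hR₂, h₂⟩ := run_loopA_iter W hw hB (O := O) (ρ := ρ) hR₁ (by omega)
    refine ⟨R₂, hR₂, ?_⟩
    rw [show 19 * (t + 1) = 19 * t + 19 by ring]
    exact run_add_of_run _ _ _ _ h₁ h₂

/-- The exit test of loop A. [folklore] -/
theorem run_loopA_exit {R : ℕ → ℕ} (hR : RegsA n R (n * n)) (H : ℕ → ℕ) :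
    ∃ R' : ℕ → ℕ, RegsA n R' (n * n) ∧
      run prog w O ρ 2 ⟨some 24, mkMem R H, 0, []⟩ = some ⟨some 43, mkMem R' H, 0, []⟩ := by
  obtain ⟨hR2, hR3, hR4, hR5, hR6, hR7, hR8, hR9, hR10, hR11⟩ := hR
  have e24 : step prog w O ρ ⟨some 24, mkMem R H, 0, []⟩ =
      some ⟨some 25, mkMem (Function.update R 14 0) H, 0, []⟩ := by
    rw [step_op_dir (by rfl), update_mkMem_lt _ _ _ (by norm_num)]
    simp only [mkMem_apply, Function.update_apply, Nat.reduceEqDiff, Nat.reduceLT, ↓reduceIte, hR2, hR3, hR4, hR5, hR6, hR7, hR8, hR9, hR10, hR11, Operand.read_dir, Operand.read_ind, Operand.read_imm]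
    rw [eval_lt, if_neg (lt_irrefl _)]
  have e25 : step prog w O ρ ⟨some 25, mkMem (Function.update R 14 0) H, 0, []⟩ =
      some ⟨some 43, mkMem (Function.update R 14 0) H, 0, []⟩ := by
    apply step_jz_taken (by rfl)
    simp [mkMem_apply, Function.update_apply]
  refine ⟨Function.update R 14 0, ?_, ?_⟩
  · refine ⟨?_, ?_, ?_, ?_, ?_, ?_, ?_, ?_, ?_, ?_⟩ <;>
      simp only [Function.update_apply, Nat.reduceEqDiff, ↓reduceIte, hR2, hR3, hR4, hR5, hR6, hR7,
        hR8, hR9, hR10, hR11]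
  · rw [run_succ_of_step _ _ _ _ e24, run_one, e25]

/-! ### Phase 4: the oracle query -/

/-- The query segment handed to the oracle. [folklore] -/
def qseg (w : ℕ) : List ℕ := readSeg (heapA W w (n * n)) (Q n) (LEN n)

/-- The heap after the oracle's answer `ans` has been written at `A0`. [folklore] -/
def heapQ (w : ℕ) (ans : List ℕ) : ℕ → ℕ :=
  writeSeg (Function.update (heapA W w (n * n)) (A0 n) ans.length) (A0 n + 1) ans

/-- **The query step.** [folklore] -/
theorem run_query {R : ℕ → ℕ} (hR : RegsA n R (n * n)) :
    run prog w O ρ 1 ⟨some 43, mkMem R (heapA W w (n * n)), 0, []⟩ =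
      some ⟨some 44, mkMem R (heapQ W w ((O (qseg W w)).map (· % 2 ^ w))), 0, [qseg W w]⟩ := by
  obtain ⟨hR2, hR3, hR4, hR5, hR6, hR7, hR8, hR9, hR10, hR11⟩ := hR
  have hQ21 : 21 ≤ Q n := by unfold Q F; omega
  have hA21 : 21 ≤ A0 n := by unfold A0 Q F; omega
  rw [run_one, step_query (i := 43) rfl (by rfl)]
  simp only [mkMem_apply, Function.update_apply, Nat.reduceEqDiff, Nat.reduceLT, ↓reduceIte, hR2, hR3, hR4, hR5, hR6, hR7, hR8, hR9, hR10, hR11, Operand.read_dir, Operand.read_ind, Operand.read_imm, List.nil_append]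
  rw [readSeg_mkMem_ge _ _ hQ21, update_mkMem_ge _ _ _ hA21, writeSeg_mkMem_ge _ _ _ (by omega)]
  rfl

end LoopAWrap

/-! ### Phase 5–7: reading the answer (loop C) and writing the output -/

/-- The word computed from an answer entry `v`: `1` iff `v ≠ 0` and `v` is even. [folklore] -/
def condVal (v : ℕ) : ℕ := if ((if v = 0 then 1 else 0) ||| (v &&& 1)) = 0 then 1 else 0

/-- Entry `t` read by loop C: word `1 + 3 n + t (4 n + 1)` of the answer (the code of the distance
from copy `0` of `t` to copy `3` of `t`). [folklore] -/
def entry (ans : List ℕ) (n t : ℕ) : ℕ := ans.getD (1 + 3 * n + t * (4 * n + 1)) 0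

/-- The flag after `t` iterations of loop C. [folklore] -/
def flagC (ans : List ℕ) (n : ℕ) : ℕ → ℕ
  | 0 => 0
  | t + 1 => flagC ans n t ||| condVal (entry ans n t)

/-- `a ||| b ≤ 1` for `a, b ≤ 1`. [folklore] -/
theorem or_le_one {x y : ℕ} (hx : x ≤ 1) (hy : y ≤ 1) : x ||| y ≤ 1 := by
  rcases Nat.le_one_iff_eq_zero_or_eq_one.1 hx with rfl | rfl <;>
    rcases Nat.le_one_iff_eq_zero_or_eq_one.1 hy with rfl | rfl <;> decide

/-- An indicator word is `≤ 1`. [folklore] -/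
theorem ite_le_one (p : Prop) [Decidable p] : (if p then 1 else 0) ≤ 1 := by split_ifs <;> simp

/-- The test word of loop C is `≤ 1`. [folklore] -/
theorem condVal_le_one (v : ℕ) : condVal v ≤ 1 := ite_le_one _

/-- The flag of loop C is `≤ 1`. [folklore] -/
theorem flagC_le_one (ans : List ℕ) (n : ℕ) : ∀ t, flagC ans n t ≤ 1
  | 0 => by simp [flagC]
  | t + 1 => or_le_one (flagC_le_one ans n t) (condVal_le_one _)

section LoopC

variable {n : ℕ} (W : Matrix (Fin n) (Fin n) ℤ) {w : ℕ} (hB : bnd n ≤ 2 ^ w) {O : List ℕ → List ℕ}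
  {ρ : ℕ → ℕ} (ans : List ℕ) (hans : ∀ v ∈ ans, v < 2 ^ w) (hlen : ans.length = LEN n)
  {qs : List (List ℕ)}

/-- The registers that loop C relies on. [folklore] -/
def RegsC (n : ℕ) (ans : List ℕ) (R : ℕ → ℕ) (t : ℕ) : Prop :=
  R 2 = n ∧ R 3 = 4 * n ∧ R 19 = 3 * n + A0 n + 2 ∧ R 20 = 4 * n + 1 ∧ R 11 = t ∧ R 17 = flagC ans n t

include hB in
/-- **Phase 5.** The six instructions after the query. [folklore] -/
theorem run_postq {R : ℕ → ℕ} (hR : RegsA n R (n * n)) (HQ : ℕ → ℕ) :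
    ∃ R' : ℕ → ℕ, RegsC n ans R' 0 ∧
      run prog w O ρ 6 ⟨some 44, mkMem R HQ, 0, qs⟩ = some ⟨some 50, mkMem R' HQ, 0, qs⟩ := by
  obtain ⟨hR2, hR3, hR4, hR5, hR6, hR7, hR8, hR9, hR10, hR11⟩ := hR
  have hbnd : bnd n = 40 * (n * n) + 80 := by unfold bnd; ring
  have hnn : n ≤ n * n := Nat.le_mul_self n
  have hA0 : A0 n = 18 * (n * n) + 35 := by unfold A0 LEN Q F; ring
  have e44 : step prog w O ρ ⟨some 44, mkMem R HQ, 0, qs⟩ =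
      some ⟨some 45, mkMem (Function.update R 19 (3 * n)) HQ, 0, qs⟩ := by
    rw [step_op_dir (by rfl), update_mkMem_lt _ _ _ (by norm_num)]
    simp only [mkMem_apply, Function.update_apply, Nat.reduceEqDiff, Nat.reduceLT, ↓reduceIte, Operand.read_dir, Operand.read_ind, Operand.read_imm, hR2, hR3, hR4, hR5, hR6, hR7, hR8, hR9, hR10, hR11]
    rw [eval_mul (show n * 3 < 2 ^ w by omega), show n * 3 = 3 * n by ring]
  set R45 : ℕ → ℕ := Function.update R 19 (3 * n) with hR45
  have e45 : step prog w O ρ ⟨some 45, mkMem R45 HQ, 0, qs⟩ =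
      some ⟨some 46, mkMem (Function.update R45 19 (3 * n + A0 n)) HQ, 0, qs⟩ := by
    rw [step_op_dir (by rfl), update_mkMem_lt _ _ _ (by norm_num)]
    simp only [hR45, mkMem_apply, Function.update_apply, Nat.reduceEqDiff, Nat.reduceLT, ↓reduceIte, Operand.read_dir, Operand.read_ind, Operand.read_imm, hR2, hR3, hR4, hR5, hR6, hR7, hR8, hR9, hR10, hR11]
    rw [eval_add (show 3 * n + A0 n < 2 ^ w by omega)]
  set R46 : ℕ → ℕ := Function.update R45 19 (3 * n + A0 n) with hR46
  have e46 : step prog w O ρ ⟨some 46, mkMem R46 HQ, 0, qs⟩ =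
      some ⟨some 47, mkMem (Function.update R46 19 (3 * n + A0 n + 2)) HQ, 0, qs⟩ := by
    rw [step_op_dir (by rfl), update_mkMem_lt _ _ _ (by norm_num)]
    simp only [hR45, hR46, mkMem_apply, Function.update_apply, Nat.reduceEqDiff, Nat.reduceLT, ↓reduceIte, Operand.read_dir, Operand.read_ind, Operand.read_imm, hR2, hR3, hR4, hR5, hR6, hR7, hR8, hR9, hR10, hR11]
    rw [eval_add (show 3 * n + A0 n + 2 < 2 ^ w by omega)]
  set R47 : ℕ → ℕ := Function.update R46 19 (3 * n + A0 n + 2) with hR47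
  have e47 : step prog w O ρ ⟨some 47, mkMem R47 HQ, 0, qs⟩ =
      some ⟨some 48, mkMem (Function.update R47 20 (4 * n + 1)) HQ, 0, qs⟩ := by
    rw [step_op_dir (by rfl), update_mkMem_lt _ _ _ (by norm_num)]
    simp only [hR45, hR46, hR47, mkMem_apply, Function.update_apply, Nat.reduceEqDiff, Nat.reduceLT, ↓reduceIte, Operand.read_dir, Operand.read_ind, Operand.read_imm, hR2, hR3, hR4, hR5, hR6, hR7, hR8, hR9, hR10, hR11]
    rw [eval_add (show 4 * n + 1 < 2 ^ w by omega)]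
  set R48 : ℕ → ℕ := Function.update R47 20 (4 * n + 1) with hR48
  have e48 : step prog w O ρ ⟨some 48, mkMem R48 HQ, 0, qs⟩ =
      some ⟨some 49, mkMem (Function.update R48 11 (0)) HQ, 0, qs⟩ := by
    rw [step_op_dir (by rfl), update_mkMem_lt _ _ _ (by norm_num)]
    simp only [hR45, hR46, hR47, hR48, mkMem_apply, Function.update_apply, Nat.reduceEqDiff, Nat.reduceLT, ↓reduceIte, Operand.read_dir, Operand.read_ind, Operand.read_imm, hR2, hR3, hR4, hR5, hR6, hR7, hR8, hR9, hR10, hR11]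
    rw [eval_add (show 0 + 0 < 2 ^ w by omega)]
  set R49 : ℕ → ℕ := Function.update R48 11 (0) with hR49
  have e49 : step prog w O ρ ⟨some 49, mkMem R49 HQ, 0, qs⟩ =
      some ⟨some 50, mkMem (Function.update R49 17 (0)) HQ, 0, qs⟩ := by
    rw [step_op_dir (by rfl), update_mkMem_lt _ _ _ (by norm_num)]
    simp only [hR45, hR46, hR47, hR48, hR49, mkMem_apply, Function.update_apply, Nat.reduceEqDiff, Nat.reduceLT, ↓reduceIte, Operand.read_dir, Operand.read_ind, Operand.read_imm, hR2, hR3, hR4, hR5, hR6, hR7, hR8, hR9, hR10, hR11]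
    rw [eval_add (show 0 + 0 < 2 ^ w by omega)]
  set R50 : ℕ → ℕ := Function.update R49 17 (0) with hR50
  refine ⟨R50, ?_, ?_⟩
  · refine ⟨?_, ?_, ?_, ?_, ?_, ?_⟩ <;>
      simp only [hR45, hR46, hR47, hR48, hR49, hR50, Function.update_apply, Nat.reduceEqDiff, ↓reduceIte, hR2, hR3, hR4, hR5, hR6, hR7, hR8, hR9, hR10, hR11, flagC]
  · rw [run_succ_of_step _ _ _ _ e44, run_succ_of_step _ _ _ _ e45, run_succ_of_step _ _ _ _ e46,
      run_succ_of_step _ _ _ _ e47, run_succ_of_step _ _ _ _ e48, run_succ_of_step _ _ _ _ e49, run_zero]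

include hB hans hlen in
/-- **One iteration of loop C** (twelve instructions). [folklore] -/
theorem run_loopC_iter {R : ℕ → ℕ} {t : ℕ} (hR : RegsC n ans R t) (ht : t < n) :
    ∃ R' : ℕ → ℕ, RegsC n ans R' (t + 1) ∧
      run prog w O ρ 12 ⟨some 50, mkMem R (heapQ W w ans), 0, qs⟩ =
        some ⟨some 50, mkMem R' (heapQ W w ans), 0, qs⟩ := by
  obtain ⟨hR2, hR3, hR19, hR20, hR11, hR17⟩ := hR
  have hbnd : bnd n = 40 * (n * n) + 80 := by unfold bnd; ring
  have hnn : n ≤ n * n := Nat.le_mul_self n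
  have hA0 : A0 n = 18 * (n * n) + 35 := by unfold A0 LEN Q F; ring
  have hLEN : LEN n = 16 * (n * n) + 1 := by unfold LEN; ring
  have ht4 : t * (4 * n + 1) + (4 * n + 1) ≤ n * (4 * n + 1) := by
    have := Nat.mul_le_mul_right (4 * n + 1) (show t + 1 ≤ n by omega); linarith
  have hn4 : n * (4 * n + 1) = 4 * (n * n) + n := by ring
  have hjt : 1 + 3 * n + t * (4 * n + 1) < ans.length := by rw [hlen, hLEN]; omega
  set e : ℕ := ans[1 + 3 * n + t * (4 * n + 1)] with he
  have hew : e < 2 ^ w := hans _ (List.getElem_mem hjt)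
  have hentry : entry ans n t = e := by
    unfold entry; rw [List.getD_eq_getElem _ _ hjt]
  have hlt54 : ¬ (t * (4 * n + 1) + (3 * n + A0 n + 2) < 21) := by omega
  have hread : heapQ W w ans (t * (4 * n + 1) + (3 * n + A0 n + 2)) = e := by
    unfold heapQ
    rw [show t * (4 * n + 1) + (3 * n + A0 n + 2) = A0 n + 1 + (1 + 3 * n + t * (4 * n + 1)) by ring,
      writeSeg_apply_add ans _ _ _ hjt]
  have hb57 : (if e = 0 then 1 else 0) ||| (e &&& 1) < 2 ^ w :=
    lt_of_le_of_lt (or_le_one (ite_le_one _) (Nat.and_le_right)) (by unfold bnd at hB; omega)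
  have hb59 : flagC ans n t ||| condVal e < 2 ^ w :=
    lt_of_le_of_lt (or_le_one (flagC_le_one ans n t) (condVal_le_one e)) (by unfold bnd at hB; omega)
  set HQ := heapQ W w ans with hHQ
  have e50 : step prog w O ρ ⟨some 50, mkMem R HQ, 0, qs⟩ =
      some ⟨some 51, mkMem (Function.update R 14 (1)) HQ, 0, qs⟩ := by
    rw [step_op_dir (by rfl), update_mkMem_lt _ _ _ (by norm_num)]
    simp only [mkMem_apply, Function.update_apply, Nat.reduceEqDiff, Nat.reduceLT, ↓reduceIte, Operand.read_dir, Operand.read_ind, Operand.read_imm, hR2, hR3, hR19, hR20, hR11, hR17, hlt54, hread]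
    rw [eval_lt, if_pos ht]
  set R51 : ℕ → ℕ := Function.update R 14 (1) with hR51
  have e51 : step prog w O ρ ⟨some 51, mkMem R51 HQ, 0, qs⟩ = some ⟨some 52, mkMem R51 HQ, 0, qs⟩ := by
    apply step_jz_fall (by rfl)
    simp [hR51, mkMem_apply, Function.update_apply]
  have e52 : step prog w O ρ ⟨some 52, mkMem R51 HQ, 0, qs⟩ =
      some ⟨some 53, mkMem (Function.update R51 16 (t * (4 * n + 1))) HQ, 0, qs⟩ := by
    rw [step_op_dir (by rfl), update_mkMem_lt _ _ _ (by norm_num)]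
    simp only [hR51, mkMem_apply, Function.update_apply, Nat.reduceEqDiff, Nat.reduceLT, ↓reduceIte, Operand.read_dir, Operand.read_ind, Operand.read_imm, hR2, hR3, hR19, hR20, hR11, hR17, hlt54, hread]
    rw [eval_mul (show t * (4 * n + 1) < 2 ^ w by omega)]
  set R53 : ℕ → ℕ := Function.update R51 16 (t * (4 * n + 1)) with hR53
  have e53 : step prog w O ρ ⟨some 53, mkMem R53 HQ, 0, qs⟩ =
      some ⟨some 54, mkMem (Function.update R53 16 (t * (4 * n + 1) + (3 * n + A0 n + 2))) HQ, 0, qs⟩ := by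
    rw [step_op_dir (by rfl), update_mkMem_lt _ _ _ (by norm_num)]
    simp only [hR51, hR53, mkMem_apply, Function.update_apply, Nat.reduceEqDiff, Nat.reduceLT, ↓reduceIte, Operand.read_dir, Operand.read_ind, Operand.read_imm, hR2, hR3, hR19, hR20, hR11, hR17, hlt54, hread]
    rw [eval_add (show t * (4 * n + 1) + (3 * n + A0 n + 2) < 2 ^ w by omega)]
  set R54 : ℕ → ℕ := Function.update R53 16 (t * (4 * n + 1) + (3 * n + A0 n + 2)) with hR54
  have e54 : step prog w O ρ ⟨some 54, mkMem R54 HQ, 0, qs⟩ =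
      some ⟨some 55, mkMem (Function.update R54 15 (e)) HQ, 0, qs⟩ := by
    rw [step_op_dir (by rfl), update_mkMem_lt _ _ _ (by norm_num)]
    simp only [hR51, hR53, hR54, mkMem_apply, Function.update_apply, Nat.reduceEqDiff, Nat.reduceLT, ↓reduceIte, Operand.read_dir, Operand.read_ind, Operand.read_imm, hR2, hR3, hR19, hR20, hR11, hR17, hlt54, hread]
    rw [eval_add (show e + 0 < 2 ^ w by omega)]
    rfl
  set R55 : ℕ → ℕ := Function.update R54 15 (e) with hR55
  have e55 : step prog w O ρ ⟨some 55, mkMem R55 HQ, 0, qs⟩ =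
      some ⟨some 56, mkMem (Function.update R55 14 (if e = 0 then 1 else 0)) HQ, 0, qs⟩ := by
    rw [step_op_dir (by rfl), update_mkMem_lt _ _ _ (by norm_num)]
    simp only [hR51, hR53, hR54, hR55, mkMem_apply, Function.update_apply, Nat.reduceEqDiff, Nat.reduceLT, ↓reduceIte, Operand.read_dir, Operand.read_ind, Operand.read_imm, hR2, hR3, hR19, hR20, hR11, hR17, hlt54, hread]
    rw [eval_eq]
  set R56 : ℕ → ℕ := Function.update R55 14 (if e = 0 then 1 else 0) with hR56
  have e56 : step prog w O ρ ⟨some 56, mkMem R56 HQ, 0, qs⟩ =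
      some ⟨some 57, mkMem (Function.update R56 18 (e &&& 1)) HQ, 0, qs⟩ := by
    rw [step_op_dir (by rfl), update_mkMem_lt _ _ _ (by norm_num)]
    simp only [hR51, hR53, hR54, hR55, hR56, mkMem_apply, Function.update_apply, Nat.reduceEqDiff, Nat.reduceLT, ↓reduceIte, Operand.read_dir, Operand.read_ind, Operand.read_imm, hR2, hR3, hR19, hR20, hR11, hR17, hlt54, hread]
    rfl
  set R57 : ℕ → ℕ := Function.update R56 18 (e &&& 1) with hR57
  have e57 : step prog w O ρ ⟨some 57, mkMem R57 HQ, 0, qs⟩ =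
      some ⟨some 58, mkMem (Function.update R57 14 ((if e = 0 then 1 else 0) ||| (e &&& 1))) HQ, 0, qs⟩ := by
    rw [step_op_dir (by rfl), update_mkMem_lt _ _ _ (by norm_num)]
    simp only [hR51, hR53, hR54, hR55, hR56, hR57, mkMem_apply, Function.update_apply, Nat.reduceEqDiff, Nat.reduceLT, ↓reduceIte, Operand.read_dir, Operand.read_ind, Operand.read_imm, hR2, hR3, hR19, hR20, hR11, hR17, hlt54, hread]
    rw [eval_bor hb57]
  set R58 : ℕ → ℕ := Function.update R57 14 ((if e = 0 then 1 else 0) ||| (e &&& 1)) with hR58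
  have e58 : step prog w O ρ ⟨some 58, mkMem R58 HQ, 0, qs⟩ =
      some ⟨some 59, mkMem (Function.update R58 14 (condVal e)) HQ, 0, qs⟩ := by
    rw [step_op_dir (by rfl), update_mkMem_lt _ _ _ (by norm_num)]
    simp only [hR51, hR53, hR54, hR55, hR56, hR57, hR58, mkMem_apply, Function.update_apply, Nat.reduceEqDiff, Nat.reduceLT, ↓reduceIte, Operand.read_dir, Operand.read_ind, Operand.read_imm, hR2, hR3, hR19, hR20, hR11, hR17, hlt54, hread]
    rw [eval_eq]
    rfl
  set R59 : ℕ → ℕ := Function.update R58 14 (condVal e) with hR59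
  have e59 : step prog w O ρ ⟨some 59, mkMem R59 HQ, 0, qs⟩ =
      some ⟨some 60, mkMem (Function.update R59 17 (flagC ans n t ||| condVal e)) HQ, 0, qs⟩ := by
    rw [step_op_dir (by rfl), update_mkMem_lt _ _ _ (by norm_num)]
    simp only [hR51, hR53, hR54, hR55, hR56, hR57, hR58, hR59, mkMem_apply, Function.update_apply, Nat.reduceEqDiff, Nat.reduceLT, ↓reduceIte, Operand.read_dir, Operand.read_ind, Operand.read_imm, hR2, hR3, hR19, hR20, hR11, hR17, hlt54, hread]
    rw [eval_bor hb59]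
  set R60 : ℕ → ℕ := Function.update R59 17 (flagC ans n t ||| condVal e) with hR60
  have e60 : step prog w O ρ ⟨some 60, mkMem R60 HQ, 0, qs⟩ =
      some ⟨some 61, mkMem (Function.update R60 11 (t + 1)) HQ, 0, qs⟩ := by
    rw [step_op_dir (by rfl), update_mkMem_lt _ _ _ (by norm_num)]
    simp only [hR51, hR53, hR54, hR55, hR56, hR57, hR58, hR59, hR60, mkMem_apply, Function.update_apply, Nat.reduceEqDiff, Nat.reduceLT, ↓reduceIte, Operand.read_dir, Operand.read_ind, Operand.read_imm, hR2, hR3, hR19, hR20, hR11, hR17, hlt54, hread]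
    rw [eval_add (show t + 1 < 2 ^ w by omega)]
  set R61 : ℕ → ℕ := Function.update R60 11 (t + 1) with hR61
  have e61 : step prog w O ρ ⟨some 61, mkMem R61 HQ, 0, qs⟩ = some ⟨some 50, mkMem R61 HQ, 0, qs⟩ :=
    step_jmp' (by rfl)
  refine ⟨R61, ?_, ?_⟩
  · refine ⟨?_, ?_, ?_, ?_, ?_, ?_⟩ <;>
      simp only [hR51, hR53, hR54, hR55, hR56, hR57, hR58, hR59, hR60, hR61, Function.update_apply, Nat.reduceEqDiff, ↓reduceIte, hR2, hR3, hR19, hR20, hR11, hR17, flagC, hentry]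
  · rw [run_succ_of_step _ _ _ _ e50, run_succ_of_step _ _ _ _ e51, run_succ_of_step _ _ _ _ e52,
      run_succ_of_step _ _ _ _ e53, run_succ_of_step _ _ _ _ e54, run_succ_of_step _ _ _ _ e55,
      run_succ_of_step _ _ _ _ e56, run_succ_of_step _ _ _ _ e57, run_succ_of_step _ _ _ _ e58,
      run_succ_of_step _ _ _ _ e59, run_succ_of_step _ _ _ _ e60, run_succ_of_step _ _ _ _ e61, run_zero]

include hB hans hlen in
/-- Loop C after `t` iterations. [folklore] -/
theorem run_loopC (t : ℕ) (ht : t ≤ n) {R : ℕ → ℕ} (hR : RegsC n ans R 0) :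
    ∃ R' : ℕ → ℕ, RegsC n ans R' t ∧
      run prog w O ρ (12 * t) ⟨some 50, mkMem R (heapQ W w ans), 0, qs⟩ =
        some ⟨some 50, mkMem R' (heapQ W w ans), 0, qs⟩ := by
  induction t with
  | zero => exact ⟨R, hR, rfl⟩
  | succ t ih =>
    obtain ⟨R₁, hR₁, h₁⟩ := ih (by omega)
    obtain ⟨R₂, hR₂, h₂⟩ := run_loopC_iter W hB ans hans hlen (O := O) (ρ := ρ) (qs := qs) hR₁ (by omega)
    refine ⟨R₂, hR₂, ?_⟩
    rw [show 12 * (t + 1) = 12 * t + 12 by ring]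
    exact run_add_of_run _ _ _ _ h₁ h₂

include hB in
/-- **Phase 7.** The exit test of loop C and the output. [folklore] -/
theorem run_finish {R : ℕ → ℕ} (hR : RegsC n ans R n) (HQ : ℕ → ℕ) :
    ∃ R' : ℕ → ℕ, R' 0 = 1 ∧ R' 1 = flagC ans n n ∧
      run prog w O ρ 5 ⟨some 50, mkMem R HQ, 0, qs⟩ = some ⟨none, mkMem R' HQ, 0, qs⟩ := by
  obtain ⟨hR2, hR3, hR19, hR20, hR11, hR17⟩ := hR
  have hfl : flagC ans n n < 2 ^ w := lt_of_le_of_lt (flagC_le_one ans n n) (by unfold bnd at hB; omega)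
  have e50 : step prog w O ρ ⟨some 50, mkMem R HQ, 0, qs⟩ =
      some ⟨some 51, mkMem (Function.update R 14 0) HQ, 0, qs⟩ := by
    rw [step_op_dir (by rfl), update_mkMem_lt _ _ _ (by norm_num)]
    simp only [mkMem_apply, Function.update_apply, Nat.reduceEqDiff, Nat.reduceLT, ↓reduceIte, Operand.read_dir, Operand.read_ind, Operand.read_imm, hR2, hR3, hR19, hR20, hR11, hR17]
    rw [eval_lt, if_neg (lt_irrefl _)]
  set R51 : ℕ → ℕ := Function.update R 14 0 with hR51
  have e51 : step prog w O ρ ⟨some 51, mkMem R51 HQ, 0, qs⟩ = some ⟨some 62, mkMem R51 HQ, 0, qs⟩ := by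
    apply step_jz_taken (by rfl)
    simp [hR51, mkMem_apply, Function.update_apply]
  have e62 : step prog w O ρ ⟨some 62, mkMem R51 HQ, 0, qs⟩ =
      some ⟨some 63, mkMem (Function.update R51 1 (flagC ans n n)) HQ, 0, qs⟩ := by
    rw [step_op_dir (by rfl), update_mkMem_lt _ _ _ (by norm_num)]
    simp only [hR51, mkMem_apply, Function.update_apply, Nat.reduceEqDiff, Nat.reduceLT, ↓reduceIte, Operand.read_dir, Operand.read_ind, Operand.read_imm, hR2, hR3, hR19, hR20, hR11, hR17]
    rw [eval_add (show flagC ans n n + 0 < 2 ^ w by omega)]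
    rfl
  set R63 : ℕ → ℕ := Function.update R51 1 (flagC ans n n) with hR63
  have e63 : step prog w O ρ ⟨some 63, mkMem R63 HQ, 0, qs⟩ =
      some ⟨some 64, mkMem (Function.update R63 0 1) HQ, 0, qs⟩ := by
    rw [step_op_dir (by rfl), update_mkMem_lt _ _ _ (by norm_num)]
    simp only [hR51, hR63, mkMem_apply, Function.update_apply, Nat.reduceEqDiff, Nat.reduceLT, ↓reduceIte, Operand.read_dir, Operand.read_ind, Operand.read_imm, hR2, hR3, hR19, hR20, hR11, hR17]
    rw [eval_add (show 1 + 0 < 2 ^ w by unfold bnd at hB; omega)]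
  set R64 : ℕ → ℕ := Function.update R63 0 1 with hR64
  have e64 : step prog w O ρ ⟨some 64, mkMem R64 HQ, 0, qs⟩ = some ⟨none, mkMem R64 HQ, 0, qs⟩ :=
    step_halt' (by rfl)
  refine ⟨R64, ?_, ?_, ?_⟩
  · simp only [hR64, hR63, hR51, Function.update_apply, Nat.reduceEqDiff, ↓reduceIte]
  · simp only [hR64, hR63, hR51, Function.update_apply, Nat.reduceEqDiff, ↓reduceIte]
  · rw [run_succ_of_step _ _ _ _ e50, run_succ_of_step _ _ _ _ e51, run_succ_of_step _ _ _ _ e62,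
      run_succ_of_step _ _ _ _ e63, run_succ_of_step _ _ _ _ e64, run_zero]

end LoopC

end Literature.Computability.FineGrained.NegTriToAPSP
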